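import Literature.AlgebraicGeometry.Kloosterman2025.ExcessTangentDimensionLowerBound
import Literature.AlgebraicGeometry.Kloosterman2025.PencilOfPairingsGenericMember
import Literature.AlgebraicGeometry.DuqueFrancoVillaflor2025.JoinArtinianGorenstein
import Literature.AlgebraicGeometry.DuqueFrancoVillaflor2025.SplitHypersurfaceFakeLinearCycles
import HarnessLib

/-!
# Kloosterman 2025, Proposition 4.7 / Theorem 4.9 (induction step): the exceptional set of a pencil of two
cycle functionals, and its descent along cones

R. Kloosterman, *On a conjecture on Hodge loci of linear combinations of linear subvarieties*, Rend. Circ. Mat.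
Palermo (2) 74 (2025) = arXiv:2312.12363 [cite: Kloosterman2025], §3 (Theorem 3.13) and §4.2 (Proposition 4.7 and
the proof of Theorem 4.9). This file is the GENERIC half of the formalisation of the counterexamples to Movasati's
conjecture (Theorem 1.2 / Theorem 4.9); the explicit base hypersurfaces (Examples 4.3, 4.4) and the headline
theorems are in `MovasatiConjectureCounterexamples.lean`, which imports this file.

Language (all from the tree: `ExcessTangentDimensionLowerBound.lean`, `PencilOfPairingsGenericMember.lean`,
`ArtinianGorensteinOfFunctional.lean`, `DuqueFrancoVillaflor2025/JoinArtinianGorenstein.lean`): functionals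
`ℓ : S → K` concentrated in one degree `t` and their Gorenstein ideals `I(ℓ) = annIdeal ℓ` (Construction 3.1 /
Lemma 2.1); a hypersurface in Kloosterman's normal form `F = twoPlanesForm gA h gC Q P`; the cycle functionals
`ciCycleFunctional ℓ gens cofs` of its two planes (Example 3.5); joins `tensorFunctional` (Duque Franco–Villaflor).

> **Proposition 4.7.** Let `0 ≤ δ ≤ d` be an integer. The dimension of the left kernel of the multiplication map
> `(I(γ̃₁)+I(γ̃₂)/I(γ̃₂))_{d−δ} × (I(γ̃₁)+I(γ̃₂)/I(γ̃₂))_{(k+1)d−2k−4+δ} → (S̃/I(γ̃₂))_{(k+2)(d−2)}` equals the sum of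
> the dimensions of the kernel of `(I(γ₁)+I(γ₂)/I(γ₂))_{d−δ'} × (I(γ₁)+I(γ₂)/I(γ₂))_{kd−2k−2+δ'} → (S/I(γ₂))_{(k+1)(d−2)}`,
> where `δ'` runs over the integers such that `δ ≤ δ' ≤ 2−(c−1)(d−2)`.
> (Proof of Thm 4.9:) "… the induction step is Proposition 4.7 … only the summand for which `α = 0` can contribute
> to a rank drop. In particular the number of `λ`, where the rank drops, does not increase."

## Contents (sorry-free; no named facts)

* §1 THE COLON CRITERION. The hypothesis of Theorem 3.13 ("the left kernel … is zero") in ideal form on `S`: every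
  `v ∈ (I₁)_a` with `v·I₁ ⊆ I₂` lies in `I₂`. Consequences (from the tree's `finite_and_ncard_excess_pos_le`):
  `excessSet_finite_of_colon`, `ncard_excessSet_le_of_colon` (`#E_a ≤ h_{I₁+I₂}(a)`, Thm 3.13); the degree shift
  `colonCriterion_of_le` (proof of Thm 4.9, "we may restrict to `δ = 0`"); Lemma 2.9 / Cor. 3.14
  (`excessSet_eq_empty_of_hilbert_eq_zero`); and the sufficient condition `colonCriterion_of_forall_mem_sup_colon`
  (`S_{t−a} ⊆ I₁ + (I₂ : I₁)`), with the monomial bookkeeping used by the examples.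
* §2 THE EXCEPTIONAL SET `excessSet ℓ₁ ℓ₂ a = {c ≠ 0 : (I₁ ∩ I₂)_a ⊊ I(ℓ₁+cℓ₂)_a}` (Kloosterman's finite set of
  `λ`, through Lemma 3.12, `c = ν(λ)`): invariance under rescaling (`excessSet_smul`, the ambiguity `ν`), under
  relabelling variables (`excessSet_comp_rename_symm`), dependence on the ideals only
  (`ncard_excessSet_eq_of_annIdeal_eq`), and JOIN DESCENT (`excessSet_tensorFunctional_subset`): for ANY functional
  `ℓ_C` on disjoint variables, `E_a(ℓ₁ ⊗ ℓ_C, ℓ₂ ⊗ ℓ_C) ⊆ ⋃_{a' ≤ a} E_{a'}(ℓ₁,ℓ₂)` — the containment half of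
  Proposition 4.7, which is what the induction uses.
* §3 THE CONE. `f̃ = f + Σ_{i<m} z_i(z_i^{d−1} + y_i^{d−1})` is again in normal form (`coneGA, coneGC, coneQ, coneP`,
  `twoPlanesForm_cone`), smooth when `f` is (`exists_X_pow_mem_jacobianIdeal_cone`, `d ≥ 3`, characteristic `0`), and
  the Gorenstein ideals of its two cone planes are the relabelled joins `I(ℓ_j ⊗ ℓ_C)`, `ℓ_C` the socle functional of
  `⊕_i ⟨y_i^{d−1}, z_i⟩` (`annIdeal_cone_plane₁_eq_map`: "`Ĩ_i = S̃ I(γ_i) + ⟨x_{2k+2}^{d−1}, x_{2k+3}⟩`", by one inclusion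
  and Artinian–Gorenstein rigidity). MAIN THEOREM `excessSet_cone` (all `m` at once): (1) `E_{a'}(base)` finite for
  all `a' ≤ a` ⇒ `E_a(cone)` finite; (2) if moreover `E_{a'}(base) = ∅` for `a' < a`, then `#E_a(cone) ≤ #E_a(base)`.
* §4 membership helpers for `I(Π₁) = (gens₁)+(cofs₁)`, `I(Π₂)`.

NOT here: the equality of dimensions in Proposition 4.7 (only the containment/inequality that Theorem 4.9 uses is
proved); the dictionary Lemma 3.6/3.12 with Hodge loci (not available in Mathlib) — statements stop at Gorenstein
ideals, as in the tree's Theorem 1.3 file. Ground field: any field (characteristic `0` where stated).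

HONEST FRAMING (cell pub-hlocus): certified instances and evidence bearing on the general Hodge conjecture; no claim.

## References

* [Klo25] R. Kloosterman, arXiv:2312.12363 = Rend. Circ. Mat. Palermo 74 (2025): Lemma 2.1, Lemma 2.9, Construction
  3.1, Example 3.5, Lemma 3.12, Theorem 3.13, Corollary 3.14, Proposition 4.7, Theorem 4.9. [cite: Kloosterman2025]
* [DFV25] J. Duque Franco, R. Villaflor Loyola, joins of Artinian Gorenstein ideals (tree
  `DuqueFrancoVillaflor2025/JoinArtinianGorenstein.lean`). [cite: DuqueFrancoVillaflor2025Join]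
-/

noncomputable section

open MvPolynomial Module Literature.RingTheory.MvPolynomial

attribute [local instance] MvPolynomial.gradedAlgebra

namespace Literature.AlgebraicGeometry.Kloosterman2025

/-! ## Section 1 — "the left kernel is zero" in ideal form, and Theorem 3.13 for Gorenstein ideals of functionals

Throughout, `ℓ₁, ℓ₂ : S → K` are functionals concentrated in degree `t` and `I_j = I(ℓ_j) = annIdeal ℓ_j`
(Kloosterman's Construction 3.1 / Lemma 2.1). The hypothesis of [Klo25, Thm. 3.13] — "the left kernel of the
multiplication map `(I₁+I₂/I₂)_d × (I₁+I₂/I₂)_{kd−2k−2} → (S/I₂)_{(k+1)(d−2)}` is zero" — reads, on `S` and with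
the roles of the indices as in the tree's `finite_and_ncard_excess_pos_le` (`ker_L φ₁ ∩ Y ≤ ker_L φ₂`):
every form `v ∈ (I₁)_a` with `v·I₁ ⊆ I₂` lies in `I₂`, i.e. `(I₁ ∩ (I₂ : I₁))_a ⊆ I₂` ("COLON CRITERION in
degree `a`" below; the two formulations are identified in `ker_inf_ker_dualRestrict_le_ker_of_colon`). -/

section LeftKernelCriterion

variable {K : Type*} [Field K] {σ : Type*} {t : ℕ} {ℓ₁ ℓ₂ : MvPolynomial σ K →ₗ[K] K}

/-- If a form `v` of degree `a` pairs to zero under `φ₂` with `(I₁)_b` (`a + b = t`), then `ℓ₂(v g) = 0` for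
EVERY `g ∈ I₁` (only the degree-`b` component of `g` is seen by `ℓ₂`, and it lies in `(I₁)_b` because `I₁`
is homogeneous). [cite: Kloosterman2025, Lemma 2.9 (proof), Theorem 3.13] -/
theorem apply_mul_eq_zero_of_forall_idealDegree
    (hℓ₁ : ∀ p, ℓ₁ (homogeneousComponent t p) = ℓ₁ p) (hℓ₂ : ∀ p, ℓ₂ (homogeneousComponent t p) = ℓ₂ p)
    {a b : ℕ} (hab : a + b = t) {v : MvPolynomial σ K} (hv : v.IsHomogeneous a)
    (H : ∀ w ∈ idealDegree (annIdeal ℓ₁) b, ℓ₂ (v * w) = 0) {g : MvPolynomial σ K}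
    (hg : g ∈ annIdeal ℓ₁) : ℓ₂ (v * g) = 0 := by
  classical
  rw [← sum_homogeneousComponent g, Finset.mul_sum, map_sum]
  refine Finset.sum_eq_zero fun e _ => ?_
  by_cases he : e = b
  · subst he
    exact H _ ⟨homogeneousComponent_mem_of_mem (isHomogeneous_annIdeal hℓ₁) hg _,
      homogeneousComponent_isHomogeneous _ g⟩
  · exact apply_eq_zero_of_isHomogeneous_ne hℓ₂ (hv.mul (homogeneousComponent_isHomogeneous e g))
      (by omega)

/-- … hence such a `v` multiplies `I₁` into `I₂`: `v ∈ (I₂ : I₁)`. [cite: Kloosterman2025, Theorem 3.13] -/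
theorem mul_mem_annIdeal_of_forall_idealDegree
    (hℓ₁ : ∀ p, ℓ₁ (homogeneousComponent t p) = ℓ₁ p) (hℓ₂ : ∀ p, ℓ₂ (homogeneousComponent t p) = ℓ₂ p)
    {a b : ℕ} (hab : a + b = t) {v : MvPolynomial σ K} (hv : v.IsHomogeneous a)
    (H : ∀ w ∈ idealDegree (annIdeal ℓ₁) b, ℓ₂ (v * w) = 0) {g : MvPolynomial σ K}
    (hg : g ∈ annIdeal ℓ₁) : v * g ∈ annIdeal ℓ₂ := by
  intro h
  rw [mul_assoc]
  exact apply_mul_eq_zero_of_forall_idealDegree hℓ₁ hℓ₂ hab hv H (Ideal.mul_mem_right _ _ hg)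

/-- **The printed hypothesis of Theorem 3.13 from the colon criterion.** If every form `v ∈ (I₁)_a` with
`v·I₁ ⊆ I₂` lies in `I₂` (`(I₁ ∩ (I₂ : I₁))_a ⊆ I₂`), then for the pairings `φ_j = gradedMulForm ℓ_j a b`
(`a + b = t`) the left kernel of `φ₂` restricted to `ker_L φ₁ × ker_R φ₁ = (I₁)_a × (I₁)_b` is as small as
possible: `ker_L φ₁ ∩ {v : φ₂(v, ker_R φ₁) = 0} ≤ ker_L φ₂` — the hypothesis of the tree's
`finite_and_ncard_excess_pos_le` ("the left kernel of `(I₁+I₂/I₂)_d × (I₁+I₂/I₂)_{kd−2k−2} → (S/I₂)` is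
zero", up to the labelling of the two cycles). [cite: Kloosterman2025, Theorem 3.13, Lemma 2.9 (proof)] -/
theorem ker_inf_ker_dualRestrict_le_ker_of_colon
    (hℓ₁ : ∀ p, ℓ₁ (homogeneousComponent t p) = ℓ₁ p) (hℓ₂ : ∀ p, ℓ₂ (homogeneousComponent t p) = ℓ₂ p)
    {a b : ℕ} (hab : a + b = t)
    (hP : ∀ v : MvPolynomial σ K, v.IsHomogeneous a → v ∈ annIdeal ℓ₁ →
      (∀ g ∈ annIdeal ℓ₁, v * g ∈ annIdeal ℓ₂) → v ∈ annIdeal ℓ₂) :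
    LinearMap.ker (gradedMulForm ℓ₁ a b) ⊓
        LinearMap.ker ((LinearMap.ker (gradedMulForm ℓ₁ a b).flip).dualRestrict ∘ₗ gradedMulForm ℓ₂ a b) ≤
      LinearMap.ker (gradedMulForm ℓ₂ a b) := by
  intro v hv
  obtain ⟨h1, h2⟩ := Submodule.mem_inf.mp hv
  have hv1 : (v : MvPolynomial σ K) ∈ annIdeal ℓ₁ := by
    rw [ker_gradedMulForm hℓ₁ hab] at h1
    exact h1.1
  have H : ∀ w ∈ idealDegree (annIdeal ℓ₁) b, ℓ₂ ((v : MvPolynomial σ K) * w) = 0 := by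
    intro w hw
    have hwker : (⟨w, hw.2⟩ : homogeneousSubmodule σ K b) ∈ LinearMap.ker (gradedMulForm ℓ₁ a b).flip := by
      rw [ker_gradedMulForm_flip hℓ₁ hab]
      exact hw
    have h3 := LinearMap.congr_fun (LinearMap.mem_ker.mp h2) ⟨⟨w, hw.2⟩, hwker⟩
    simpa [Submodule.dualRestrict_apply] using h3
  rw [ker_gradedMulForm hℓ₂ hab]
  exact ⟨hP _ v.2 hv1 (fun g hg => mul_mem_annIdeal_of_forall_idealDegree hℓ₁ hℓ₂ hab v.2 H hg), v.2⟩

/-- `I₁ ∩ I₂ ⊆ I(ℓ₁ + c ℓ₂)`: the common Gorenstein ideal kills every member of the pencil.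
[cite: Kloosterman2025, Notation 2.4, Lemma 3.12] -/
theorem inf_annIdeal_le_annIdeal_add_smul (c : K) : annIdeal ℓ₁ ⊓ annIdeal ℓ₂ ≤ annIdeal (ℓ₁ + c • ℓ₂) := by
  intro g hg h
  simpa using apply_mul_eq_zero_of_mem_inf hg c h

/-- The left kernel of the pencil member `φ₁ + cφ₂ : S_a × S_b → K` IS the degree-`a` piece of the Gorenstein ideal
of the functional `ℓ₁ + cℓ₂` (`a + b = t`). [cite: Kloosterman2025, Lemma 2.1, Lemma 3.12] -/
theorem ker_gradedMulForm_add_smul_eq_comap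
    (hℓ₁ : ∀ p, ℓ₁ (homogeneousComponent t p) = ℓ₁ p) (hℓ₂ : ∀ p, ℓ₂ (homogeneousComponent t p) = ℓ₂ p)
    {a b : ℕ} (hab : a + b = t) (c : K) :
    LinearMap.ker (gradedMulForm (ℓ₁ + c • ℓ₂) a b) =
      (idealDegree (annIdeal (ℓ₁ + c • ℓ₂)) a).comap (homogeneousSubmodule σ K a).subtype :=
  ker_gradedMulForm (add_smul_homogeneousComponent hℓ₁ hℓ₂ c) hab

variable [Finite σ]

/-- **Excess in two languages.** For `c ∈ K` and `a + b = t`: the excess of the pencil member is positive in the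
tree's kernel form, `dim (I₁∩I₂)_a < dim ker_L(φ₁ + cφ₂)|_{S_a}`, iff `(I₁ ∩ I₂)_a ⊊ I(ℓ₁ + cℓ₂)_a` (the
form used in `ExcessTangentDimensionLowerBound.lean`: "`T_X NL([Y₁],[Y₂]) ⊊ T_X NL([Y₁]+λ[Y₂])`").
[cite: Kloosterman2025, Lemma 3.12] -/
theorem finrank_lt_finrank_ker_iff_idealDegree_lt
    (hℓ₁ : ∀ p, ℓ₁ (homogeneousComponent t p) = ℓ₁ p) (hℓ₂ : ∀ p, ℓ₂ (homogeneousComponent t p) = ℓ₂ p)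
    {a b : ℕ} (hab : a + b = t) (c : K) :
    finrank K (idealDegree (annIdeal ℓ₁ ⊓ annIdeal ℓ₂) a) <
        finrank K (LinearMap.ker (gradedMulForm (ℓ₁ + c • ℓ₂) a b)) ↔
      idealDegree (annIdeal ℓ₁ ⊓ annIdeal ℓ₂) a < idealDegree (annIdeal (ℓ₁ + c • ℓ₂)) a := by
  have hle : idealDegree (annIdeal ℓ₁ ⊓ annIdeal ℓ₂) a ≤ idealDegree (annIdeal (ℓ₁ + c • ℓ₂)) a :=
    idealDegree_mono (inf_annIdeal_le_annIdeal_add_smul c) a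
  rw [ker_gradedMulForm_add_smul_eq_comap hℓ₁ hℓ₂ hab c,
    (Submodule.comapSubtypeEquivOfLe (idealDegree_le_homogeneousSubmodule _ _)).finrank_eq]
  constructor
  · intro h
    exact lt_of_le_of_ne hle fun heq => by rw [heq] at h; exact lt_irrefl _ h
  · intro h
    exact Submodule.finrank_lt_finrank_of_lt h

/-- **Theorem 3.13 (first assertion) for the Gorenstein ideals of two functionals, from the colon criterion.** If
`(I₁ ∩ (I₂ : I₁))_a ⊆ I₂` and `a + b = t`, then the set of `c ≠ 0` with POSITIVE EXCESS
`dim (I₁ ∩ I₂)_a < dim ker_L((φ₁ + cφ₂)|_{S_a × S_b})` is finite, with at most `h_{I₂}(a) = dim S_a − dim (I₂)_a`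
elements ("for all but finitely many `λ ∈ ℚ*` we have `codim T_X NL([Y₁]+λ[Y₂]) = codim T_X NL([Y₁],[Y₂])`").
[cite: Kloosterman2025, Theorem 3.13] -/
theorem finite_setOf_excess_pos_of_colon
    (hℓ₁ : ∀ p, ℓ₁ (homogeneousComponent t p) = ℓ₁ p) (hℓ₂ : ∀ p, ℓ₂ (homogeneousComponent t p) = ℓ₂ p)
    {a b : ℕ} (hab : a + b = t)
    (hP : ∀ v : MvPolynomial σ K, v.IsHomogeneous a → v ∈ annIdeal ℓ₁ →
      (∀ g ∈ annIdeal ℓ₁, v * g ∈ annIdeal ℓ₂) → v ∈ annIdeal ℓ₂) :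
    {c : K | c ≠ 0 ∧ finrank K (idealDegree (annIdeal ℓ₁ ⊓ annIdeal ℓ₂) a) <
        finrank K (LinearMap.ker (gradedMulForm (ℓ₁ + c • ℓ₂) a b))}.Finite ∧
      {c : K | c ≠ 0 ∧ finrank K (idealDegree (annIdeal ℓ₁ ⊓ annIdeal ℓ₂) a) <
        finrank K (LinearMap.ker (gradedMulForm (ℓ₁ + c • ℓ₂) a b))}.ncard ≤
        finrank K (homogeneousSubmodule σ K a) - finrank K (idealDegree (annIdeal ℓ₂) a) := by
  haveI := finite_homogeneousSubmodule (K := K) (σ := σ) a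
  haveI := finite_homogeneousSubmodule (K := K) (σ := σ) b
  obtain ⟨hfin, hcard⟩ := finite_and_ncard_excess_pos_le (gradedMulForm ℓ₁ a b) (gradedMulForm ℓ₂ a b)
    (ker_inf_ker_dualRestrict_le_ker_of_colon hℓ₁ hℓ₂ hab hP)
  have e3 : LinearMap.ker (gradedMulForm ℓ₁ a b) ⊓ LinearMap.ker (gradedMulForm ℓ₂ a b) =
      (idealDegree (annIdeal ℓ₁ ⊓ annIdeal ℓ₂) a).comap (homogeneousSubmodule σ K a).subtype := by
    rw [ker_gradedMulForm hℓ₁ hab, ker_gradedMulForm hℓ₂ hab, ← Submodule.comap_inf, ← idealDegree_inf]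
  have efin : finrank K ↥(LinearMap.ker (gradedMulForm ℓ₁ a b) ⊓ LinearMap.ker (gradedMulForm ℓ₂ a b)) =
      finrank K (idealDegree (annIdeal ℓ₁ ⊓ annIdeal ℓ₂) a) := by
    rw [e3]
    exact (Submodule.comapSubtypeEquivOfLe (idealDegree_le_homogeneousSubmodule _ _)).finrank_eq
  have hset : {c : K | c ≠ 0 ∧ finrank K ↥(LinearMap.ker (gradedMulForm ℓ₁ a b) ⊓
        LinearMap.ker (gradedMulForm ℓ₂ a b)) <
          finrank K (LinearMap.ker (gradedMulForm ℓ₁ a b + c • gradedMulForm ℓ₂ a b))} =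
      {c : K | c ≠ 0 ∧ finrank K (idealDegree (annIdeal ℓ₁ ⊓ annIdeal ℓ₂) a) <
        finrank K (LinearMap.ker (gradedMulForm (ℓ₁ + c • ℓ₂) a b))} := by
    ext c
    rw [Set.mem_setOf_eq, Set.mem_setOf_eq, efin, gradedMulForm_add_smul]
  rw [hset] at hfin hcard
  exact ⟨hfin, hcard.trans (le_of_eq (finrank_range_gradedMulForm hℓ₂ hab))⟩

/-- **The bound of Theorem 3.13's second assertion, over an infinite field** (e.g. `ℚ`, `ℂ`): under the colon
criterion the number of `c ≠ 0` with positive excess is at most `h_{I₁+I₂}(a) = dim S_a − dim (I₁+I₂)_a` ("for at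
most `h_{I₁+I₂}(d)` nonzero values of `λ` there is a strict inequality", Lemma 2.3 `h_{I₁∩I₂} + h_{I₁+I₂} =
h_{I₁} + h_{I₂}`). [cite: Kloosterman2025, Theorem 3.13, Lemma 2.6, Lemma 2.3] -/
theorem ncard_setOf_excess_pos_le_hilbert_sup [Infinite K]
    (hℓ₁ : ∀ p, ℓ₁ (homogeneousComponent t p) = ℓ₁ p) (hℓ₂ : ∀ p, ℓ₂ (homogeneousComponent t p) = ℓ₂ p)
    {a b : ℕ} (hab : a + b = t)
    (hP : ∀ v : MvPolynomial σ K, v.IsHomogeneous a → v ∈ annIdeal ℓ₁ →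
      (∀ g ∈ annIdeal ℓ₁, v * g ∈ annIdeal ℓ₂) → v ∈ annIdeal ℓ₂) :
    {c : K | c ≠ 0 ∧ finrank K (idealDegree (annIdeal ℓ₁ ⊓ annIdeal ℓ₂) a) <
        finrank K (LinearMap.ker (gradedMulForm (ℓ₁ + c • ℓ₂) a b))}.ncard ≤
      finrank K (homogeneousSubmodule σ K a) - finrank K (idealDegree (annIdeal ℓ₁ ⊔ annIdeal ℓ₂) a) := by
  haveI := finite_homogeneousSubmodule (K := K) (σ := σ) a
  haveI := finite_homogeneousSubmodule (K := K) (σ := σ) b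
  have h := ncard_excess_pos_add_le_of_infinite (gradedMulForm ℓ₁ a b) (gradedMulForm ℓ₂ a b)
    (ker_inf_ker_dualRestrict_le_ker_of_colon hℓ₁ hℓ₂ hab hP)
  have e3 : LinearMap.ker (gradedMulForm ℓ₁ a b) ⊓ LinearMap.ker (gradedMulForm ℓ₂ a b) =
      (idealDegree (annIdeal ℓ₁ ⊓ annIdeal ℓ₂) a).comap (homogeneousSubmodule σ K a).subtype := by
    rw [ker_gradedMulForm hℓ₁ hab, ker_gradedMulForm hℓ₂ hab, ← Submodule.comap_inf, ← idealDegree_inf]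
  have efin : finrank K ↥(LinearMap.ker (gradedMulForm ℓ₁ a b) ⊓ LinearMap.ker (gradedMulForm ℓ₂ a b)) =
      finrank K (idealDegree (annIdeal ℓ₁ ⊓ annIdeal ℓ₂) a) := by
    rw [e3]
    exact (Submodule.comapSubtypeEquivOfLe (idealDegree_le_homogeneousSubmodule _ _)).finrank_eq
  have hset : {c : K | c ≠ 0 ∧ finrank K ↥(LinearMap.ker (gradedMulForm ℓ₁ a b) ⊓
        LinearMap.ker (gradedMulForm ℓ₂ a b)) <
          finrank K (LinearMap.ker (gradedMulForm ℓ₁ a b + c • gradedMulForm ℓ₂ a b))} =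
      {c : K | c ≠ 0 ∧ finrank K (idealDegree (annIdeal ℓ₁ ⊓ annIdeal ℓ₂) a) <
        finrank K (LinearMap.ker (gradedMulForm (ℓ₁ + c • ℓ₂) a b))} := by
    ext c
    rw [Set.mem_setOf_eq, Set.mem_setOf_eq, efin, gradedMulForm_add_smul]
  rw [hset, efin, finrank_range_gradedMulForm hℓ₁ hab, finrank_range_gradedMulForm hℓ₂ hab] at h
  have hmod := finrank_idealDegree_inf_add_sup (isHomogeneous_annIdeal hℓ₁) (isHomogeneous_annIdeal hℓ₂) a
  have h1 := finrank_idealDegree_le (annIdeal ℓ₁) a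
  have h2 := finrank_idealDegree_le (annIdeal ℓ₂) a
  have h3 := finrank_idealDegree_le (annIdeal ℓ₁ ⊓ annIdeal ℓ₂) a
  have h4 := finrank_idealDegree_le (annIdeal ℓ₁ ⊔ annIdeal ℓ₂) a
  omega

/-- **No excess outside the exceptional set**: for `c ≠ 0` outside the finite set above, the left kernel of
`φ₁ + cφ₂` on `S_a` is exactly `(I₁ ∩ I₂)_a` ("`NL([Π₁]+λ[Π₂]) = NL([Π₁],[Π₂])` in a neighborhood of `X`", at the
level of Zariski tangent spaces). [cite: Kloosterman2025, Theorem 3.13, Theorem 4.9] -/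
theorem ker_gradedMulForm_add_smul_eq_of_not_excess {a b : ℕ} {c : K}
    (hc : ¬ finrank K (idealDegree (annIdeal ℓ₁ ⊓ annIdeal ℓ₂) a) <
        finrank K (LinearMap.ker (gradedMulForm (ℓ₁ + c • ℓ₂) a b))) :
    LinearMap.ker (gradedMulForm (ℓ₁ + c • ℓ₂) a b) =
      (idealDegree (annIdeal ℓ₁ ⊓ annIdeal ℓ₂) a).comap (homogeneousSubmodule σ K a).subtype := by
  haveI := finite_homogeneousSubmodule (K := K) (σ := σ) a
  have hle : (idealDegree (annIdeal ℓ₁ ⊓ annIdeal ℓ₂) a).comap (homogeneousSubmodule σ K a).subtype ≤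
      LinearMap.ker (gradedMulForm (ℓ₁ + c • ℓ₂) a b) :=
    comap_idealDegree_inf_le_ker_gradedMulForm_add_smul c a b
  have efin : finrank K ↥((idealDegree (annIdeal ℓ₁ ⊓ annIdeal ℓ₂) a).comap
      (homogeneousSubmodule σ K a).subtype) = finrank K (idealDegree (annIdeal ℓ₁ ⊓ annIdeal ℓ₂) a) :=
    (Submodule.comapSubtypeEquivOfLe (idealDegree_le_homogeneousSubmodule _ _)).finrank_eq
  exact (Submodule.eq_of_le_of_finrank_le hle (by rw [efin]; exact not_lt.mp hc)).symm

omit [Finite σ] in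
/-- **Degree shift** ([Klo25, proof of Thm. 4.9]: "if the hypothesis holds for `δ = 0` … then it holds … for all
`δ`", Lemma (lemDegShift)): the colon criterion in degree `a + 1 ≤ t` implies it in degree `a` — if `v ∈ (I₁)_a`
multiplies `I₁` into `I₂`, so does every `x_i v`, hence `x_i v ∈ I₂` for all `i`, hence `v ∈ I₂` (the socle of
`S/I₂` sits in degree `t`). [cite: Kloosterman2025, Theorem 4.9 (proof), Lemma 2.10 (proof)] -/
theorem colonCriterion_of_succ (hℓ₂ : ∀ p, ℓ₂ (homogeneousComponent t p) = ℓ₂ p) {a : ℕ} (ha : a < t)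
    (hP : ∀ v : MvPolynomial σ K, v.IsHomogeneous (a + 1) → v ∈ annIdeal ℓ₁ →
      (∀ g ∈ annIdeal ℓ₁, v * g ∈ annIdeal ℓ₂) → v ∈ annIdeal ℓ₂) :
    ∀ v : MvPolynomial σ K, v.IsHomogeneous a → v ∈ annIdeal ℓ₁ →
      (∀ g ∈ annIdeal ℓ₁, v * g ∈ annIdeal ℓ₂) → v ∈ annIdeal ℓ₂ := by
  intro v hv h1 h2
  refine mem_annIdeal_of_forall_X_mul_mem hℓ₂ hv ha fun i =>
    hP _ ?_ (Ideal.mul_mem_left _ _ h1) fun g hg => ?_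
  · have := (isHomogeneous_X K i).mul hv
    rwa [add_comm] at this
  · rw [mul_assoc]
    exact Ideal.mul_mem_left _ _ (h2 g hg)

omit [Finite σ] in
/-- The colon criterion in degree `a ≤ t` implies it in every degree `a' ≤ a`. [cite: Kloosterman2025, Theorem 4.9 (proof)] -/
theorem colonCriterion_of_le (hℓ₂ : ∀ p, ℓ₂ (homogeneousComponent t p) = ℓ₂ p) {a a' : ℕ} (hat : a ≤ t)
    (ha' : a' ≤ a)
    (hP : ∀ v : MvPolynomial σ K, v.IsHomogeneous a → v ∈ annIdeal ℓ₁ →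
      (∀ g ∈ annIdeal ℓ₁, v * g ∈ annIdeal ℓ₂) → v ∈ annIdeal ℓ₂) :
    ∀ v : MvPolynomial σ K, v.IsHomogeneous a' → v ∈ annIdeal ℓ₁ →
      (∀ g ∈ annIdeal ℓ₁, v * g ∈ annIdeal ℓ₂) → v ∈ annIdeal ℓ₂ := by
  -- induction on `a − a'`
  have aux : ∀ n a₀ : ℕ, a₀ + n ≤ t →
      (∀ v : MvPolynomial σ K, v.IsHomogeneous (a₀ + n) → v ∈ annIdeal ℓ₁ →
        (∀ g ∈ annIdeal ℓ₁, v * g ∈ annIdeal ℓ₂) → v ∈ annIdeal ℓ₂) →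
      ∀ v : MvPolynomial σ K, v.IsHomogeneous a₀ → v ∈ annIdeal ℓ₁ →
        (∀ g ∈ annIdeal ℓ₁, v * g ∈ annIdeal ℓ₂) → v ∈ annIdeal ℓ₂ := by
    intro n
    induction n with
    | zero => intro a₀ _ h; simpa using h
    | succ n ih =>
      intro a₀ hn h
      refine colonCriterion_of_succ hℓ₂ (by omega) (ih (a₀ + 1) (by omega) ?_)
      rwa [show a₀ + 1 + n = a₀ + (n + 1) by omega]
  obtain ⟨n, rfl⟩ := Nat.exists_eq_add_of_le ha'
  exact aux n a' hat hP

omit [Finite σ] in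
/-- **A sufficient condition for the colon criterion** (how the examples of §4.2 are certified here, in place
of the rank of the Gram matrix): if every form of the complementary degree `b = t − a` lies in
`I₁ + (I₂ : I₁)`, then every `v ∈ (I₁)_a` with `v·I₁ ⊆ I₂` pairs to zero with all of `S_b` under `ℓ₂`, hence
lies in `I₂`. [cite: Kloosterman2025, Theorem 3.13, Lemma 2.1] -/
theorem colonCriterion_of_forall_mem_sup_colon (hℓ₂ : ∀ p, ℓ₂ (homogeneousComponent t p) = ℓ₂ p) {a b : ℕ}
    (hab : a + b = t)
    (H : ∀ w : MvPolynomial σ K, w.IsHomogeneous b →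
      w ∈ annIdeal ℓ₁ ⊔ (annIdeal ℓ₂).colon (annIdeal ℓ₁ : Set (MvPolynomial σ K))) :
    ∀ v : MvPolynomial σ K, v.IsHomogeneous a → v ∈ annIdeal ℓ₁ →
      (∀ g ∈ annIdeal ℓ₁, v * g ∈ annIdeal ℓ₂) → v ∈ annIdeal ℓ₂ := by
  intro v hv h1 h2
  refine mem_annIdeal_of_forall_isHomogeneous hℓ₂ hv hab fun w hw => ?_
  obtain ⟨w₁, hw₁, w₂, hw₂, rfl⟩ := Submodule.mem_sup.mp (H w hw)
  have e1 : ℓ₂ (v * w₁) = 0 := apply_eq_zero_of_mem_annIdeal (h2 w₁ hw₁)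
  have e2 : ℓ₂ (v * w₂) = 0 := by
    rw [mul_comm]
    have := Submodule.mem_colon.mp hw₂ v h1
    rw [smul_eq_mul] at this
    exact apply_eq_zero_of_mem_annIdeal this
  rw [mul_add, map_add, e1, e2, add_zero]

omit [Finite σ] in
/-- `u ∈ (J : I)` as soon as `I ⊆ (J : u)` (commutativity; how membership in the colon ideal `(I₂ : I₁)` of the
hypothesis of Theorem 3.13 is checked on generators of `I₁`). [cite: Kloosterman2025, Theorem 3.13 (hypothesis), Example 4.3] -/
theorem mem_colon_of_le_colon_singleton {R : Type*} [CommRing R] {I J : Ideal R} {u : R}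
    (h : I ≤ J.colon {u}) : u ∈ J.colon (I : Set R) := by
  refine Submodule.mem_colon.mpr fun s hs => ?_
  have := Submodule.mem_colon_singleton.mp (h hs)
  rw [smul_eq_mul] at this ⊢
  rw [mul_comm]; exact this

omit [Finite σ] in
/-- `J ⊆ (J : I)`. [cite: Kloosterman2025, Theorem 3.13 (hypothesis)] -/
theorem le_colon_set {R : Type*} [CommRing R] (I J : Ideal R) : J ≤ J.colon (I : Set R) :=
  fun _ hr => Submodule.mem_colon.mpr fun s _ => by rw [smul_eq_mul]; exact J.mul_mem_right s hr

omit [Finite σ] in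
/-- A monomial divisible by `x_l^e ∈ I` lies in `I` (the monomial bookkeeping of Example 4.3: "a `ℂ`-basis for
`(S/I₁+I₂)_4` is given by `∏ x_i^{a_i}` such that `Σ a_i = 4` and one of `a_2>0, a_3>0, a_4>2, a_5>2` holds").
[cite: Kloosterman2025, Example 4.3] -/
theorem monomial_mem_of_X_pow_mem {I : Ideal (MvPolynomial σ K)} {l : σ} {e : ℕ}
    (hX : (X l : MvPolynomial σ K) ^ e ∈ I) {s : σ →₀ ℕ} (hs : e ≤ s l) : monomial s (1 : K) ∈ I := by
  classical
  have key : monomial s (1 : K) = monomial (s - Finsupp.single l e) 1 * X l ^ e := by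
    rw [X_pow_eq_monomial, monomial_mul, mul_one, tsub_add_cancel_of_le (Finsupp.single_le_iff.mpr hs)]
  rw [key]
  exact I.mul_mem_left _ hX

omit [Finite σ] in
/-- A monomial divisible by `x_l ∈ I` lies in `I`. [cite: Kloosterman2025, Example 4.3] -/
theorem monomial_mem_of_X_mem {I : Ideal (MvPolynomial σ K)} {l : σ} (hX : (X l : MvPolynomial σ K) ∈ I)
    {s : σ →₀ ℕ} (hs : s l ≠ 0) : monomial s (1 : K) ∈ I :=
  monomial_mem_of_X_pow_mem (e := 1) (by rwa [pow_one]) (Nat.one_le_iff_ne_zero.mpr hs)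

omit [Finite σ] in
/-- A form of degree `b` lies in an ideal containing every monomial of degree `b`. [cite: Kloosterman2025, Example 4.3] -/
theorem mem_of_forall_monomial_mem {I : Ideal (MvPolynomial σ K)} {w : MvPolynomial σ K} {b : ℕ}
    (hw : w.IsHomogeneous b) (H : ∀ s : σ →₀ ℕ, s.degree = b → monomial s (1 : K) ∈ I) : w ∈ I := by
  rw [w.as_sum]
  refine Ideal.sum_mem _ fun s hs => ?_
  have hdeg : s.degree = b := by
    rw [Finsupp.degree_eq_weight_one]; exact hw (mem_support_iff.mp hs)
  have e : monomial s (coeff s w) = coeff s w • monomial s (1 : K) := by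
    rw [smul_monomial, smul_eq_mul, mul_one]
  rw [e]
  exact Submodule.smul_of_tower_mem _ _ (H s hdeg)

end LeftKernelCriterion

/-! ## Section 2 — the exceptional set of a pencil, and its behaviour under scaling, relabelling and joins

For two functionals `ℓ₁, ℓ₂` on `S = K[x_σ]` and a degree `a`, the EXCEPTIONAL SET
`E_a(ℓ₁,ℓ₂) = {c ≠ 0 : (I₁ ∩ I₂)_a ⊊ I(ℓ₁ + cℓ₂)_a}` is the set of parameters of the pencil at which the
excess is positive (Kloosterman's finite set `S` of Theorem 1.2 / the "finitely many `λ`" of Theorems 3.13, 4.9,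
read through Lemma 3.12: `c = ν(λ)`, `(I₁ ∩ I₂)_d = T_X NL(Y₁,Y₂)`, `I(ℓ₁ + cℓ₂)_d = T_X NL([Y₁]+λ[Y₂])`). -/

section ExcessSet

variable {K : Type*} [Field K] {σ : Type*} {t : ℕ} {ℓ₁ ℓ₂ : MvPolynomial σ K →ₗ[K] K}

/-- **The exceptional set of the pencil `ℓ₁ + cℓ₂` in degree `a`**: the `c ≠ 0` with
`(I(ℓ₁) ∩ I(ℓ₂))_a ⊊ I(ℓ₁ + cℓ₂)_a` (positive excess tangent dimension of `NL([Y₁]+λ[Y₂])` over `NL([Y₁],[Y₂])`,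
`c = ν(λ)`). [cite: Kloosterman2025, Theorem 1.2, Lemma 3.12, Theorem 3.13] -/
def excessSet (ℓ₁ ℓ₂ : MvPolynomial σ K →ₗ[K] K) (a : ℕ) : Set K :=
  {c | c ≠ 0 ∧ idealDegree (annIdeal ℓ₁ ⊓ annIdeal ℓ₂) a < idealDegree (annIdeal (ℓ₁ + c • ℓ₂)) a}

/-- Membership in the exceptional set. [cite: Kloosterman2025, Theorem 3.13] -/
theorem mem_excessSet_iff {a : ℕ} {c : K} : c ∈ excessSet ℓ₁ ℓ₂ a ↔
    c ≠ 0 ∧ idealDegree (annIdeal ℓ₁ ⊓ annIdeal ℓ₂) a < idealDegree (annIdeal (ℓ₁ + c • ℓ₂)) a := Iff.rfl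

/-- Membership through a witness: `c ≠ 0` is exceptional in degree `a` iff some form of degree `a` lies in
`I(ℓ₁ + cℓ₂)` but not in `I₁ ∩ I₂`. [cite: Kloosterman2025, Lemma 3.12, Theorem 3.13] -/
theorem mem_excessSet_iff_exists {a : ℕ} {c : K} : c ∈ excessSet ℓ₁ ℓ₂ a ↔
    c ≠ 0 ∧ ∃ w : MvPolynomial σ K, w.IsHomogeneous a ∧ w ∈ annIdeal (ℓ₁ + c • ℓ₂) ∧
      w ∉ annIdeal ℓ₁ ⊓ annIdeal ℓ₂ := by
  rw [mem_excessSet_iff]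
  refine and_congr_right fun _ => ?_
  have hle : idealDegree (annIdeal ℓ₁ ⊓ annIdeal ℓ₂) a ≤ idealDegree (annIdeal (ℓ₁ + c • ℓ₂)) a :=
    idealDegree_mono (inf_annIdeal_le_annIdeal_add_smul c) a
  constructor
  · intro hlt
    obtain ⟨w, hw, hw'⟩ := SetLike.exists_of_lt hlt
    exact ⟨w, hw.2, hw.1, fun h => hw' ⟨h, hw.2⟩⟩
  · rintro ⟨w, hwa, hwin, hwout⟩
    refine lt_of_le_of_ne hle fun heq => hwout ?_
    have hmem : w ∈ idealDegree (annIdeal (ℓ₁ + c • ℓ₂)) a := ⟨hwin, hwa⟩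
    rw [← heq] at hmem
    exact hmem.1

/-- **Outside the exceptional set there is no excess**: for `c ≠ 0`, `c ∉ E_a(ℓ₁,ℓ₂)` means
`I(ℓ₁ + cℓ₂)_a = (I₁ ∩ I₂)_a` — through Lemmas 3.6/3.12 (`a = d`): `T_X NL([Y₁]+λ[Y₂]) = T_X NL(Y₁,Y₂)`,
"`codim T_X NL([Π₁]+λ[Π₂]) = codim T_X NL([Π₁],[Π₂])`". [cite: Kloosterman2025, Theorem 1.2, Theorem 4.9, Lemma 3.12] -/
theorem idealDegree_annIdeal_add_smul_eq_of_notMem_excessSet {a : ℕ} {c : K} (hc0 : c ≠ 0)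
    (hc : c ∉ excessSet ℓ₁ ℓ₂ a) :
    idealDegree (annIdeal (ℓ₁ + c • ℓ₂)) a = idealDegree (annIdeal ℓ₁ ⊓ annIdeal ℓ₂) a := by
  have hle : idealDegree (annIdeal ℓ₁ ⊓ annIdeal ℓ₂) a ≤ idealDegree (annIdeal (ℓ₁ + c • ℓ₂)) a :=
    idealDegree_mono (inf_annIdeal_le_annIdeal_add_smul c) a
  rw [mem_excessSet_iff, not_and] at hc
  exact (eq_of_le_of_not_lt hle (hc hc0)).symm

/-- The exceptional set in the tree's kernel language (for `a + b = t`): `c ∈ E_a` iff `c ≠ 0` and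
`dim (I₁ ∩ I₂)_a < dim ker_L((φ₁ + cφ₂)|_{S_a × S_b})`. [cite: Kloosterman2025, Lemma 3.12, Theorem 3.13] -/
theorem mem_excessSet_iff_finrank_lt [Finite σ]
    (hℓ₁ : ∀ p, ℓ₁ (homogeneousComponent t p) = ℓ₁ p) (hℓ₂ : ∀ p, ℓ₂ (homogeneousComponent t p) = ℓ₂ p)
    {a b : ℕ} (hab : a + b = t) {c : K} : c ∈ excessSet ℓ₁ ℓ₂ a ↔
    c ≠ 0 ∧ finrank K (idealDegree (annIdeal ℓ₁ ⊓ annIdeal ℓ₂) a) <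
      finrank K (LinearMap.ker (gradedMulForm (ℓ₁ + c • ℓ₂) a b)) := by
  rw [mem_excessSet_iff, finrank_lt_finrank_ker_iff_idealDegree_lt hℓ₁ hℓ₂ hab]

/-- **Theorem 3.13 for the exceptional set**: under the colon criterion in degree `a` (`a + b = t`), `E_a(ℓ₁,ℓ₂)` is
finite. [cite: Kloosterman2025, Theorem 3.13] -/
theorem excessSet_finite_of_colon [Finite σ]
    (hℓ₁ : ∀ p, ℓ₁ (homogeneousComponent t p) = ℓ₁ p) (hℓ₂ : ∀ p, ℓ₂ (homogeneousComponent t p) = ℓ₂ p)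
    {a b : ℕ} (hab : a + b = t)
    (hP : ∀ v : MvPolynomial σ K, v.IsHomogeneous a → v ∈ annIdeal ℓ₁ →
      (∀ g ∈ annIdeal ℓ₁, v * g ∈ annIdeal ℓ₂) → v ∈ annIdeal ℓ₂) :
    (excessSet ℓ₁ ℓ₂ a).Finite := by
  have hset : excessSet ℓ₁ ℓ₂ a = {c : K | c ≠ 0 ∧ finrank K (idealDegree (annIdeal ℓ₁ ⊓ annIdeal ℓ₂) a) <
      finrank K (LinearMap.ker (gradedMulForm (ℓ₁ + c • ℓ₂) a b))} :=
    Set.ext fun c => mem_excessSet_iff_finrank_lt hℓ₁ hℓ₂ hab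
  rw [hset]
  exact (finite_setOf_excess_pos_of_colon hℓ₁ hℓ₂ hab hP).1

/-- … with at most `h_{I₁+I₂}(a)` elements over an infinite field (`ℚ`, `ℂ`). [cite: Kloosterman2025, Theorem 3.13] -/
theorem ncard_excessSet_le_of_colon [Finite σ] [Infinite K]
    (hℓ₁ : ∀ p, ℓ₁ (homogeneousComponent t p) = ℓ₁ p) (hℓ₂ : ∀ p, ℓ₂ (homogeneousComponent t p) = ℓ₂ p)
    {a b : ℕ} (hab : a + b = t)
    (hP : ∀ v : MvPolynomial σ K, v.IsHomogeneous a → v ∈ annIdeal ℓ₁ →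
      (∀ g ∈ annIdeal ℓ₁, v * g ∈ annIdeal ℓ₂) → v ∈ annIdeal ℓ₂) :
    (excessSet ℓ₁ ℓ₂ a).ncard ≤
      finrank K (homogeneousSubmodule σ K a) - finrank K (idealDegree (annIdeal ℓ₁ ⊔ annIdeal ℓ₂) a) := by
  have hset : excessSet ℓ₁ ℓ₂ a = {c : K | c ≠ 0 ∧ finrank K (idealDegree (annIdeal ℓ₁ ⊓ annIdeal ℓ₂) a) <
      finrank K (LinearMap.ker (gradedMulForm (ℓ₁ + c • ℓ₂) a b))} :=
    Set.ext fun c => mem_excessSet_iff_finrank_lt hℓ₁ hℓ₂ hab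
  rw [hset]
  exact ncard_setOf_excess_pos_le_hilbert_sup hℓ₁ hℓ₂ hab hP

/-- **Lemma 2.9 for the exceptional set**: if `(I₁)_b + (I₂)_b = S_b` (`h_{I₁+I₂}(b) = 0`, `a + b = t`) then
`E_a(ℓ₁,ℓ₂) = ∅` ("if `h_{I₁+I₂}(t−α) = 0` then for all `λ ∈ ℂ*` we have `ker_L(φ₁ + λφ₂) = 0`").
[cite: Kloosterman2025, Lemma 2.9, Corollary 3.14] -/
theorem excessSet_eq_empty_of_sup_eq
    (hℓ₁ : ∀ p, ℓ₁ (homogeneousComponent t p) = ℓ₁ p) (hℓ₂ : ∀ p, ℓ₂ (homogeneousComponent t p) = ℓ₂ p)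
    {a b : ℕ} (hab : a + b = t)
    (hspan : idealDegree (annIdeal ℓ₁) b ⊔ idealDegree (annIdeal ℓ₂) b = homogeneousSubmodule σ K b) :
    excessSet ℓ₁ ℓ₂ a = ∅ := by
  refine Set.eq_empty_iff_forall_notMem.mpr fun c hc => ?_
  obtain ⟨hc0, w, hwa, hwin, hwout⟩ := mem_excessSet_iff_exists.mp hc
  refine hwout (mem_inf_annIdeal_of_forall_add_smul_eq_zero hℓ₁ hℓ₂ hab hspan hc0 hwa fun h hh => ?_)
  simpa using hwin h

/-- The same with the hypothesis as the vanishing `h_{I₁+I₂}(b) = 0` of a Hilbert function.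
[cite: Kloosterman2025, Lemma 2.9, Corollary 3.14] -/
theorem excessSet_eq_empty_of_hilbert_eq_zero [Finite σ]
    (hℓ₁ : ∀ p, ℓ₁ (homogeneousComponent t p) = ℓ₁ p) (hℓ₂ : ∀ p, ℓ₂ (homogeneousComponent t p) = ℓ₂ p)
    {a b : ℕ} (hab : a + b = t)
    (h : finrank K (homogeneousSubmodule σ K b) - finrank K (idealDegree (annIdeal ℓ₁ ⊔ annIdeal ℓ₂) b) = 0) :
    excessSet ℓ₁ ℓ₂ a = ∅ :=
  excessSet_eq_empty_of_sup_eq hℓ₁ hℓ₂ hab (idealDegree_sup_eq_top_of_hilbert_eq_zero hℓ₁ hℓ₂ h)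

/-- **Scaling the two functionals rescales the exceptional set**: for `u₁, u₂ ≠ 0`,
`E_a(u₁ℓ₁, u₂ℓ₂) = (u₁u₂⁻¹) · E_a(ℓ₁,ℓ₂)` (the Gorenstein ideals only determine `ℓ_j` up to a scalar, and
`u₁ℓ₁ + c u₂ℓ₂ = u₁(ℓ₁ + (c u₂u₁⁻¹) ℓ₂)`). [cite: Kloosterman2025, Lemma 3.12 (the parameter `ν(λ)`)] -/
theorem excessSet_smul {u₁ u₂ : K} (hu₁ : u₁ ≠ 0) (hu₂ : u₂ ≠ 0) (a : ℕ) :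
    excessSet (u₁ • ℓ₁) (u₂ • ℓ₂) a = (fun c => c * (u₁ * u₂⁻¹)) '' excessSet ℓ₁ ℓ₂ a := by
  have key : ∀ c : K, annIdeal (u₁ • ℓ₁ + c • (u₂ • ℓ₂)) = annIdeal (ℓ₁ + (c * u₂ * u₁⁻¹) • ℓ₂) := by
    intro c
    have : u₁ • ℓ₁ + c • (u₂ • ℓ₂) = u₁ • (ℓ₁ + (c * u₂ * u₁⁻¹) • ℓ₂) := by
      rw [smul_add, smul_smul, smul_smul]
      congr 2
      field_simp
    rw [this, MovasatiVillaflor2018.annIdeal_smul _ hu₁]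
  ext c
  simp only [Set.mem_image, mem_excessSet_iff, MovasatiVillaflor2018.annIdeal_smul _ hu₁,
    MovasatiVillaflor2018.annIdeal_smul _ hu₂, key]
  constructor
  · rintro ⟨hc, hlt⟩
    refine ⟨c * u₂ * u₁⁻¹, ⟨?_, hlt⟩, by field_simp⟩
    exact mul_ne_zero (mul_ne_zero hc hu₂) (inv_ne_zero hu₁)
  · rintro ⟨c', ⟨hc', hlt⟩, rfl⟩
    refine ⟨mul_ne_zero hc' (mul_ne_zero hu₁ (inv_ne_zero hu₂)), ?_⟩
    have e : c' * (u₁ * u₂⁻¹) * u₂ * u₁⁻¹ = c' := by field_simp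
    rwa [e]

/-- Hence rescaling preserves finiteness and the number of exceptional values. [cite: Kloosterman2025, Lemma 3.12] -/
theorem ncard_excessSet_smul {u₁ u₂ : K} (hu₁ : u₁ ≠ 0) (hu₂ : u₂ ≠ 0) (a : ℕ) :
    (excessSet (u₁ • ℓ₁) (u₂ • ℓ₂) a).ncard = (excessSet ℓ₁ ℓ₂ a).ncard ∧
      ((excessSet (u₁ • ℓ₁) (u₂ • ℓ₂) a).Finite ↔ (excessSet ℓ₁ ℓ₂ a).Finite) := by
  have hinj : Function.Injective fun c : K => c * (u₁ * u₂⁻¹) :=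
    mul_left_injective₀ (mul_ne_zero hu₁ (inv_ne_zero hu₂))
  rw [excessSet_smul hu₁ hu₂]
  exact ⟨Set.ncard_image_of_injective _ hinj, Set.finite_image_iff hinj.injOn⟩

/-- **Two socle functionals of the same Gorenstein ideals have exceptional sets of the same size** (in every
degree): the exceptional set is an invariant of the pair of ideals `I₁, I₂` up to the scaling `c ↦ u c`.
[cite: Kloosterman2025, Lemma 3.12, Construction 3.1] -/
theorem ncard_excessSet_eq_of_annIdeal_eq [Finite σ] {ℓ₁' ℓ₂' : MvPolynomial σ K →ₗ[K] K}
    (hℓ₁ : ∀ p, ℓ₁ (homogeneousComponent t p) = ℓ₁ p) (hℓ₂ : ∀ p, ℓ₂ (homogeneousComponent t p) = ℓ₂ p)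
    (hℓ₁' : ∀ p, ℓ₁' (homogeneousComponent t p) = ℓ₁' p) (hℓ₂' : ∀ p, ℓ₂' (homogeneousComponent t p) = ℓ₂' p)
    (hne₁ : ℓ₁' ≠ 0) (hne₂ : ℓ₂' ≠ 0) (h₁ : annIdeal ℓ₁' = annIdeal ℓ₁) (h₂ : annIdeal ℓ₂' = annIdeal ℓ₂)
    (a : ℕ) :
    (excessSet ℓ₁' ℓ₂' a).ncard = (excessSet ℓ₁ ℓ₂ a).ncard ∧
      ((excessSet ℓ₁' ℓ₂' a).Finite ↔ (excessSet ℓ₁ ℓ₂ a).Finite) := by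
  obtain ⟨u₁, hu₁, rfl⟩ :=
    (DuqueFrancoVillaflor2025.annIdeal_eq_annIdeal_iff_exists_smul hℓ₁ hℓ₁' hne₁).mp h₁.symm
  obtain ⟨u₂, hu₂, rfl⟩ :=
    (DuqueFrancoVillaflor2025.annIdeal_eq_annIdeal_iff_exists_smul hℓ₂ hℓ₂' hne₂).mp h₂.symm
  exact ncard_excessSet_smul hu₁ hu₂ a

end ExcessSet

/-! ### Relabelling the variables -/

section Rename

variable {K : Type*} [Field K] {α β : Type*}

/-- For a bijection `θ` of variable sets, `I.map (rename θ) = I.comap (rename θ⁻¹)`. [folklore] -/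
private theorem map_rename_eq_comap_rename_symm (θ : α ≃ β) (I : Ideal (MvPolynomial α K)) :
    I.map (rename θ : MvPolynomial α K →ₐ[K] MvPolynomial β K) =
      I.comap (rename θ.symm : MvPolynomial β K →ₐ[K] MvPolynomial α K) := by
  apply le_antisymm
  · refine Ideal.map_le_iff_le_comap.mpr fun g hg => ?_
    rw [Ideal.mem_comap, Ideal.mem_comap, rename_rename, Equiv.symm_comp_self, rename_id, AlgHom.id_apply]
    exact hg
  · intro q hq
    rw [Ideal.mem_comap] at hq
    have h : rename θ (rename θ.symm q) = q := by
      rw [rename_rename, Equiv.self_comp_symm, rename_id, AlgHom.id_apply]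
    rw [← h]
    exact Ideal.mem_map_of_mem _ hq

/-- Membership in a relabelled ideal: `q ∈ I.map (rename θ) ↔ rename θ⁻¹ q ∈ I` for a bijection `θ`.
[folklore] -/
private theorem mem_map_rename_equiv_iff' (θ : α ≃ β) (I : Ideal (MvPolynomial α K)) (q : MvPolynomial β K) :
    q ∈ I.map (rename θ : MvPolynomial α K →ₐ[K] MvPolynomial β K) ↔ rename θ.symm q ∈ I := by
  rw [map_rename_eq_comap_rename_symm, Ideal.mem_comap]

/-- The Gorenstein ideal of a functional pulled back along a relabelling `θ` of the variables is the relabelled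
ideal: `I(ℓ ∘ rename θ⁻¹)·= I(ℓ).map (rename θ)`. [cite: Kloosterman2025, Lemma 2.1] -/
theorem annIdeal_comp_rename_symm (θ : α ≃ β) (ℓ : MvPolynomial α K →ₗ[K] K) :
    annIdeal (ℓ ∘ₗ (rename θ.symm : MvPolynomial β K →ₐ[K] MvPolynomial α K).toLinearMap) =
      (annIdeal ℓ).map (rename θ : MvPolynomial α K →ₐ[K] MvPolynomial β K) := by
  rw [MovasatiVillaflor2018.annIdeal_comp_of_surjective _
    (fun p => ⟨rename θ p, by rw [rename_rename, Equiv.symm_comp_self, rename_id, AlgHom.id_apply]⟩),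
    map_rename_eq_comap_rename_symm]

/-- **The exceptional set does not depend on the names of the variables**: pulling both functionals back along
a relabelling `θ` leaves `E_a` unchanged. [cite: Kloosterman2025, Lemma 3.12] -/
theorem excessSet_comp_rename_symm (θ : α ≃ β) (ℓ₁ ℓ₂ : MvPolynomial α K →ₗ[K] K) (a : ℕ) :
    excessSet (ℓ₁ ∘ₗ (rename θ.symm : MvPolynomial β K →ₐ[K] MvPolynomial α K).toLinearMap)
        (ℓ₂ ∘ₗ (rename θ.symm : MvPolynomial β K →ₐ[K] MvPolynomial α K).toLinearMap) a =
      excessSet ℓ₁ ℓ₂ a := by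
  ext c
  simp only [mem_excessSet_iff_exists]
  refine and_congr_right fun _ => ?_
  have hsum : ℓ₁ ∘ₗ (rename θ.symm : MvPolynomial β K →ₐ[K] MvPolynomial α K).toLinearMap +
      c • (ℓ₂ ∘ₗ (rename θ.symm : MvPolynomial β K →ₐ[K] MvPolynomial α K).toLinearMap) =
        (ℓ₁ + c • ℓ₂) ∘ₗ (rename θ.symm : MvPolynomial β K →ₐ[K] MvPolynomial α K).toLinearMap := by
    rw [LinearMap.add_comp, LinearMap.smul_comp]
  rw [hsum, annIdeal_comp_rename_symm, annIdeal_comp_rename_symm, annIdeal_comp_rename_symm]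
  constructor
  · rintro ⟨w, hwa, hwin, hwout⟩
    refine ⟨rename θ.symm w, hwa.rename_isHomogeneous, (mem_map_rename_equiv_iff' θ _ w).mp hwin,
      fun h => hwout ⟨?_, ?_⟩⟩
    · exact (mem_map_rename_equiv_iff' θ _ w).mpr h.1
    · exact (mem_map_rename_equiv_iff' θ _ w).mpr h.2
  · rintro ⟨w, hwa, hwin, hwout⟩
    refine ⟨rename θ w, hwa.rename_isHomogeneous, ?_, fun h => hwout ⟨?_, ?_⟩⟩
    · rw [mem_map_rename_equiv_iff', rename_rename, Equiv.symm_comp_self, rename_id]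
      exact hwin
    · have h1 := (mem_map_rename_equiv_iff' θ _ _).mp h.1
      rwa [rename_rename, Equiv.symm_comp_self, rename_id] at h1
    · have h2 := (mem_map_rename_equiv_iff' θ _ _).mp h.2
      rwa [rename_rename, Equiv.symm_comp_self, rename_id] at h2

/-- Pulling back along a relabelling preserves concentration in degree `t`. [folklore] -/
private theorem comp_rename_homogeneousComponent {t : ℕ} (θ : α ≃ β) {ℓ : MvPolynomial α K →ₗ[K] K}
    (hℓ : ∀ p, ℓ (homogeneousComponent t p) = ℓ p) (q : MvPolynomial β K) :
    (ℓ ∘ₗ (rename θ.symm : MvPolynomial β K →ₐ[K] MvPolynomial α K).toLinearMap) (homogeneousComponent t q) =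
      (ℓ ∘ₗ (rename θ.symm : MvPolynomial β K →ₐ[K] MvPolynomial α K).toLinearMap) q := by
  simp only [LinearMap.coe_comp, Function.comp_apply, AlgHom.toLinearMap_apply]
  rw [rename_homogeneousComponent, hℓ]

end Rename

/-! ### Joins: the exceptional set of `ℓ₁ ⊗ ℓ_C, ℓ₂ ⊗ ℓ_C` descends to `ℓ₁, ℓ₂` (the mechanism of Prop. 4.7)

Kloosterman's Prop. 4.7 computes the left kernel of the pencil of the cone `X̃` (one more pair of variables,
`Ĩ_j = S̃ I_j + ⟨x_{2k+2}^{d−1}, x_{2k+3}⟩`) as a direct sum of left kernels of the pencil of `X` in degrees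
`d − δ'`, `δ' ≥ 0`. In the inverse-system language `Ĩ_j = I(ℓ_j ⊗ ℓ_C)` with `ℓ_C` the socle functional of
`⟨y^{d−1}, z⟩` (tree `annIdeal_tensorFunctional`), and the part of Prop. 4.7 that drives Theorem 4.9 is the
CONTAINMENT: a witness of positive excess for `ℓ₁ ⊗ ℓ_C, ℓ₂ ⊗ ℓ_C` in degree `a` contracts (by `id ⊗ ℓ_C`) to a
witness for `ℓ₁, ℓ₂` in some degree `a' ≤ a`. This holds for the join with ANY functional `ℓ_C` on a disjoint
set of variables, which is how it is proved here (so the `m`-fold cone is ONE join). -/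

section JoinDescent

open DuqueFrancoVillaflor2025

variable {K : Type*} [Field K] {σ τ : Type*} {t tC : ℕ} {ℓ₁ ℓ₂ : MvPolynomial σ K →ₗ[K] K}
  {ℓC : MvPolynomial τ K →ₗ[K] K}

/-- The contraction `id ⊗ ℓ_C` by a functional concentrated in degree `t_C` lowers degrees by `t_C`: it maps
forms of degree `n` to forms of degree `n − t_C` (and kills forms of degree `< t_C`).
[cite: Kloosterman2025, Proposition 4.7 (proof)] -/
theorem isHomogeneous_tensorContract (hℓC : ∀ p, ℓC (homogeneousComponent tC p) = ℓC p)
    {p : MvPolynomial (σ ⊕ τ) K} {n : ℕ} (hp : p.IsHomogeneous n) :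
    (tensorContract (σ := σ) ℓC p).IsHomogeneous (n - tC) := by
  classical
  rw [p.as_sum, map_sum]
  refine IsHomogeneous.sum _ _ _ fun s hs => ?_
  rw [monomial_eq_rename_mul_rename s (coeff s p), tensorContract_mul_rename]
  by_cases h : (Finsupp.sumFinsuppEquivProdFinsupp s).2.degree = tC
  · have hsn : s.degree = n := by
      rw [Finsupp.degree_eq_weight_one]
      exact hp (mem_support_iff.mp hs)
    have h1 : (Finsupp.sumFinsuppEquivProdFinsupp s).1.degree = n - tC := by
      have := degree_eq_degree_add_degree s
      omega
    rw [smul_monomial]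
    exact isHomogeneous_monomial _ h1
  · rw [apply_eq_zero_of_isHomogeneous_ne hℓC (isHomogeneous_monomial _ rfl) h, zero_smul]
    exact isHomogeneous_zero _ _ _

/-- `id ⊗ 0 = 0`. [folklore] -/
private theorem tensorContract_zero : tensorContract (σ := σ) (0 : MvPolynomial τ K →ₗ[K] K) = 0 :=
  linearMap_ext_of_mul_rename fun p q => by rw [tensorContract_mul_rename]; simp

/-- Contracting against a `y`-factor from `I(ℓ_C)` gives zero: `(id ⊗ ℓ_C)(v · q(y)) = 0` for `q ∈ I(ℓ_C)`.
[cite: DuqueFrancoVillaflor2025Join, Theorem 1.1 (proof)] -/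
theorem tensorContract_mul_rename_inr_eq_zero (v : MvPolynomial (σ ⊕ τ) K) {q : MvPolynomial τ K}
    (hq : q ∈ annIdeal ℓC) : tensorContract ℓC (v * rename Sum.inr q) = 0 := by
  have h0 : ℓC ∘ₗ LinearMap.mulRight K q = 0 :=
    LinearMap.ext fun h => by simpa [mul_comm] using hq h
  rw [tensorContract_mul_rename_inr, h0, tensorContract_zero, LinearMap.zero_apply]

/-- **Membership in `I(ℓ ⊗ ℓ_C)` is tested on contractions**: if `(id ⊗ ℓ_C)(v·q(y)) ∈ I(ℓ)` for every
`q ∈ K[y]`, then `v ∈ I(ℓ ⊗ ℓ_C)` (pure tensors span `K[x ⊔ y]`). [cite: DuqueFrancoVillaflor2025Join, Theorem 1.1 (proof)] -/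
theorem mem_annIdeal_tensorFunctional_of_forall {ℓ : MvPolynomial σ K →ₗ[K] K} {v : MvPolynomial (σ ⊕ τ) K}
    (H : ∀ q : MvPolynomial τ K, tensorContract ℓC (v * rename Sum.inr q) ∈ annIdeal ℓ) :
    v ∈ annIdeal (tensorFunctional ℓ ℓC) := by
  intro h
  have key : tensorFunctional ℓ ℓC ∘ₗ LinearMap.mulLeft K v = 0 :=
    linearMap_ext_of_mul_rename fun p q => by
      simp only [LinearMap.coe_comp, Function.comp_apply, LinearMap.mulLeft_apply, LinearMap.zero_apply]
      rw [show v * (rename Sum.inl p * rename Sum.inr q) = v * rename Sum.inr q * rename Sum.inl p by ring,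
        tensorFunctional_apply, tensorContract_mul_rename_inl]
      exact H q p
  simpa using LinearMap.congr_fun key h

/-- … and it suffices to test `q` HOMOGENEOUS OF DEGREE `≤ t_C` (other degrees contract to `0` or lie in
`I(ℓ_C)`): if `v ∉ I(ℓ ⊗ ℓ_C)` then some `(id ⊗ ℓ_C)(v·q(y))` with `q` a form of degree `e ≤ t_C` is not in
`I(ℓ)`. [cite: Kloosterman2025, Proposition 4.7 (proof)] -/
theorem exists_tensorContract_notMem (hℓC : ∀ p, ℓC (homogeneousComponent tC p) = ℓC p)
    {ℓ : MvPolynomial σ K →ₗ[K] K} {v : MvPolynomial (σ ⊕ τ) K} (hv : v ∉ annIdeal (tensorFunctional ℓ ℓC)) :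
    ∃ e ≤ tC, ∃ q : MvPolynomial τ K, q.IsHomogeneous e ∧
      tensorContract ℓC (v * rename Sum.inr q) ∉ annIdeal ℓ := by
  classical
  by_contra H
  push Not at H
  refine hv (mem_annIdeal_tensorFunctional_of_forall fun q => ?_)
  rw [← sum_homogeneousComponent q, map_sum, Finset.mul_sum, map_sum]
  refine Ideal.sum_mem _ fun e _ => ?_
  by_cases he : tC < e
  · rw [tensorContract_mul_rename_inr_eq_zero v
      (mem_annIdeal_of_isHomogeneous_of_lt hℓC (homogeneousComponent_isHomogeneous e q) he)]
    exact Ideal.zero_mem _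
  · exact H e (not_lt.mp he) _ (homogeneousComponent_isHomogeneous e q)

/-- The pencil of the join is the join of the pencil: `(ℓ₁ + cℓ₂) ⊗ ℓ_C = ℓ₁ ⊗ ℓ_C + c (ℓ₂ ⊗ ℓ_C)`.
[cite: Kloosterman2025, Proposition 4.7] -/
theorem tensorFunctional_add_smul (c : K) :
    tensorFunctional (ℓ₁ + c • ℓ₂) ℓC = tensorFunctional ℓ₁ ℓC + c • tensorFunctional ℓ₂ ℓC := by
  simp only [tensorFunctional, LinearMap.add_comp, LinearMap.smul_comp]

/-- **Descent of a witness (Prop. 4.7, the containment).** If a form `v` of degree `a` on `K[x ⊔ y]` lies in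
`I((ℓ₁ + cℓ₂) ⊗ ℓ_C)` but not in `I(ℓ₁ ⊗ ℓ_C) ∩ I(ℓ₂ ⊗ ℓ_C)`, then some contraction `(id ⊗ ℓ_C)(v·q(y))` is a form
of degree `a' ≤ a` in `I(ℓ₁ + cℓ₂)` not in `I(ℓ₁) ∩ I(ℓ₂)` ("the left kernel of the multiplication map [for
`X̃`] equals the sum of … the kernel[s] of [the maps for `X`] where `δ'` runs over the integers `δ ≤ δ'`").
[cite: Kloosterman2025, Proposition 4.7] -/
theorem exists_witness_of_witness_tensor (hℓC : ∀ p, ℓC (homogeneousComponent tC p) = ℓC p) {c : K} {a : ℕ}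
    {v : MvPolynomial (σ ⊕ τ) K} (hv : v.IsHomogeneous a)
    (hvin : v ∈ annIdeal (tensorFunctional (ℓ₁ + c • ℓ₂) ℓC))
    (hvout : v ∉ annIdeal (tensorFunctional ℓ₁ ℓC) ⊓ annIdeal (tensorFunctional ℓ₂ ℓC)) :
    ∃ a' ≤ a, ∃ w : MvPolynomial σ K, w.IsHomogeneous a' ∧ w ∈ annIdeal (ℓ₁ + c • ℓ₂) ∧
      w ∉ annIdeal ℓ₁ ⊓ annIdeal ℓ₂ := by
  have main : ∀ {ℓ : MvPolynomial σ K →ₗ[K] K}, v ∉ annIdeal (tensorFunctional ℓ ℓC) →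
      ∃ a' ≤ a, ∃ w : MvPolynomial σ K, w.IsHomogeneous a' ∧ w ∈ annIdeal (ℓ₁ + c • ℓ₂) ∧ w ∉ annIdeal ℓ := by
    intro ℓ hvℓ
    obtain ⟨e, he, q, hq, hnot⟩ := exists_tensorContract_notMem hℓC hvℓ
    refine ⟨a + e - tC, by omega, tensorContract ℓC (v * rename Sum.inr q), ?_, ?_, hnot⟩
    · exact isHomogeneous_tensorContract hℓC (hv.mul hq.rename_isHomogeneous)
    · exact tensorContract_mul_mem_annIdeal (ℓ₁ + c • ℓ₂) ℓC hvin q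
  by_cases h1 : v ∈ annIdeal (tensorFunctional ℓ₁ ℓC)
  · have h2 : v ∉ annIdeal (tensorFunctional ℓ₂ ℓC) := fun h2 => hvout ⟨h1, h2⟩
    obtain ⟨a', ha', w, hwa, hwin, hwout⟩ := main h2
    exact ⟨a', ha', w, hwa, hwin, fun h => hwout h.2⟩
  · obtain ⟨a', ha', w, hwa, hwin, hwout⟩ := main h1
    exact ⟨a', ha', w, hwa, hwin, fun h => hwout h.1⟩

/-- **The exceptional set of a join is contained in the exceptional sets of the factor, over all lower degrees**:
`E_a(ℓ₁ ⊗ ℓ_C, ℓ₂ ⊗ ℓ_C) ⊆ ⋃_{a' ≤ a} E_{a'}(ℓ₁, ℓ₂)` — the cone/join acquires no new exceptional `λ`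
(Prop. 4.7 ⇒ "In particular the number of `λ`, where the rank drops, does not increase", proof of Thm. 4.9).
[cite: Kloosterman2025, Proposition 4.7, Theorem 4.9 (proof)] -/
theorem excessSet_tensorFunctional_subset (hℓC : ∀ p, ℓC (homogeneousComponent tC p) = ℓC p) (a : ℕ) :
    excessSet (tensorFunctional ℓ₁ ℓC) (tensorFunctional ℓ₂ ℓC) a ⊆ ⋃ a' ≤ a, excessSet ℓ₁ ℓ₂ a' := by
  intro c hc
  obtain ⟨hc0, v, hva, hvin, hvout⟩ := mem_excessSet_iff_exists.mp hc
  rw [← tensorFunctional_add_smul] at hvin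
  obtain ⟨a', ha', w, hwa, hwin, hwout⟩ := exists_witness_of_witness_tensor hℓC hva hvin hvout
  exact Set.mem_biUnion ha' (mem_excessSet_iff_exists.mpr ⟨hc0, w, hwa, hwin, hwout⟩)

/-- Finiteness along a join: if `E_{a'}(ℓ₁,ℓ₂)` is finite for every `a' ≤ a`, so is `E_a(ℓ₁ ⊗ ℓ_C, ℓ₂ ⊗ ℓ_C)`.
[cite: Kloosterman2025, Proposition 4.7, Theorem 4.9] -/
theorem excessSet_tensorFunctional_finite (hℓC : ∀ p, ℓC (homogeneousComponent tC p) = ℓC p) {a : ℕ}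
    (hfin : ∀ a' ≤ a, (excessSet ℓ₁ ℓ₂ a').Finite) :
    (excessSet (tensorFunctional ℓ₁ ℓC) (tensorFunctional ℓ₂ ℓC) a).Finite := by
  refine Set.Finite.subset ?_ (excessSet_tensorFunctional_subset hℓC a)
  have e : (⋃ a' ≤ a, excessSet ℓ₁ ℓ₂ a') = ⋃ a' ∈ Finset.range (a + 1), excessSet ℓ₁ ℓ₂ a' := by
    ext c
    simp
  rw [e]
  exact Set.Finite.biUnion (Finset.finite_toSet _) fun a' ha' => hfin a' (by simpa [Nat.lt_succ_iff] using ha')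

/-- **"The number of `λ` where the rank drops does not increase"**: if the factor has no exceptional values in
degrees `< a`, the exceptional set of the join in degree `a` is contained in that of the factor, so has at most as
many elements. [cite: Kloosterman2025, Theorem 4.9 (proof)] -/
theorem excessSet_tensorFunctional_subset_of_forall_lt (hℓC : ∀ p, ℓC (homogeneousComponent tC p) = ℓC p)
    {a : ℕ} (hempty : ∀ a' < a, excessSet ℓ₁ ℓ₂ a' = ∅) :
    excessSet (tensorFunctional ℓ₁ ℓC) (tensorFunctional ℓ₂ ℓC) a ⊆ excessSet ℓ₁ ℓ₂ a := by
  intro c hc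
  obtain ⟨a', ha', hc'⟩ := Set.mem_iUnion₂.mp (excessSet_tensorFunctional_subset hℓC a hc)
  rcases ha'.lt_or_eq with hlt | rfl
  · rw [hempty a' hlt] at hc'
    exact absurd hc' (Set.notMem_empty c)
  · exact hc'

end JoinDescent

/-! ## Section 3 — the cone `X̃ = V(f + x_{2k+3}^d + x_{2k+3}x_{2k+2}^{d−1})` and its iteration (Prop. 4.7, Thm. 4.9)

"Consider `f̃ = f + x_{2k+3}^d + x_{2k+3}x_{2k+2}^{d−1}` and `X̃ = V(f̃) ⊂ ℙ^{2k+3}`. Then the cone `C(Y_j)` over `Y_j` in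
`V(x_{2k+3}) ≅ ℙ^{2k+2}` is contained in `X̃` … `Ĩ_j := I(γ̃_j) = S̃ I(γ_j) + ⟨x_{2k+2}^{d−1}, x_{2k+3}⟩`" (p. 12). Here the
block `z(z^{d−1} + y^{d−1})` (`y = x_{2k+2}`, `z = x_{2k+3}`) is added `m` times at once: in Kloosterman's normal form the
new plane generators are the `z_i` (shared by both planes) with cofactors `P = z_i^{d−1} + y_i^{d−1}`. -/

section ConeBlock

open DuqueFrancoVillaflor2025 HodgeTheory Motives.UniversalHypersurface

variable {K : Type*} [Field K]

/-- The cone block `z·(z^{d−1} + y^{d−1}) = x_{2k+3}^d + x_{2k+3}x_{2k+2}^{d−1}` in the variables `y = x_0`, `z = x_1`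
of `K[x_0,x_1]`. [cite: Kloosterman2025, §4.2 (the construction before Proposition 4.7)] -/
def coneBlockForm (d : ℕ) : MvPolynomial (Fin 2) K := X 1 * (X 1 ^ (d - 1) + X 0 ^ (d - 1))

/-- The generators `y^{d−1}, z` of the ideal the cone adds to both `I(γ̃_j)` ("`Ĩ_j = S̃ I(γ_j) + ⟨x_{2k+2}^{d−1}, x_{2k+3}⟩`").
[cite: Kloosterman2025, Proposition 4.7 (proof)] -/
def coneBlockGens (d : ℕ) : Fin 2 → MvPolynomial (Fin 2) K := ![X 0 ^ (d - 1), X 1]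

/-- First block generator `y^{d−1}`. [cite: Kloosterman2025, Proposition 4.7 (proof)] -/
@[simp] theorem coneBlockGens_zero (d : ℕ) : coneBlockGens (K := K) d 0 = X 0 ^ (d - 1) := rfl
/-- Second block generator `z`. [cite: Kloosterman2025, Proposition 4.7 (proof)] -/
@[simp] theorem coneBlockGens_one (d : ℕ) : coneBlockGens (K := K) d 1 = X 1 := rfl

/-- `⟨y^{d−1}, z⟩ ⊂ K[y,z]` is Artinian Gorenstein of socle degree `d − 2` (a complete intersection of degrees `d−1, 1`;
its quotient is `K[y]/(y^{d−1})`, the factor `⊕_{i=0}^{d−2} x_{2k+2}^i (S/I(γ_j))` of the printed proof).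
[cite: Kloosterman2025, Proposition 4.7 (proof)] [cite: VoisinHodgeII2003, Thm. 6.19] -/
theorem isArtinianGorenstein_coneBlock {d : ℕ} (hd : 2 ≤ d) :
    IsArtinianGorenstein (Ideal.span (Set.range (coneBlockGens (K := K) d))) (d - 2) := by
  have hG : ∀ i, (coneBlockGens (K := K) d i).IsHomogeneous ((![d - 1, 1] : Fin 2 → ℕ) i) := by
    intro i
    fin_cases i
    · exact isHomogeneous_X_pow _ _
    · exact isHomogeneous_X K 1
  have hdeg : ∀ i, 0 < (![d - 1, 1] : Fin 2 → ℕ) i := by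
    intro i
    fin_cases i
    · show 0 < d - 1; omega
    · exact Nat.one_pos
  have hXN : ∀ i, (X i : MvPolynomial (Fin 2) K) ^ (d - 1) ∈ Ideal.span (Set.range (coneBlockGens (K := K) d)) := by
    refine Fin.forall_fin_two.mpr ⟨Ideal.subset_span ⟨0, rfl⟩, ?_⟩
    have e : (X 1 : MvPolynomial (Fin 2) K) ^ (d - 1) = X 1 ^ (d - 2) * X 1 := by
      rw [← pow_succ]; congr 1; omega
    rw [e]
    exact Ideal.mul_mem_left _ _ (Ideal.subset_span ⟨1, rfl⟩)
  have h := HodgeTheory.isArtinianGorenstein_span_of_X_pow_mem (coneBlockGens (K := K) d) ![d - 1, 1] hG hdeg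
    (N := d - 1) (by omega) hXN
  have e : ∑ i : Fin 2, ((![d - 1, 1] : Fin 2 → ℕ) i - 1) = d - 2 := by
    simp [Fin.sum_univ_two]; omega
  rwa [e] at h

/-- Dividing out an integer: `n ≠ 0` in `K` and `n·p ∈ I` give `p ∈ I` (used to read the integer certificates
`D·x_l^N = Σ h_u ∂_u f` of smoothness, "`X = V(f)` is smooth"). [cite: Kloosterman2025, Example 4.3, Theorem 4.9 (proof)] -/
theorem mem_of_natCast_mul_mem {σ : Type*} (n : ℕ) (hn : (n : K) ≠ 0) {I : Ideal (MvPolynomial σ K)}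
    {p : MvPolynomial σ K} (h : (n : MvPolynomial σ K) * p ∈ I) : p ∈ I := by
  have e : p = C ((n : K)⁻¹) * ((n : MvPolynomial σ K) * p) := by
    rw [← mul_assoc, ← map_natCast (C : K →+* MvPolynomial σ K) n, ← map_mul, inv_mul_cancel₀ hn, map_one,
      one_mul]
  rw [e]
  exact Ideal.mul_mem_left _ _ h

/-- `∂/∂y (z(z^{d−1} + y^{d−1})) = (d−1) z y^{d−2}` (written with `d = e + 3`). [cite: Kloosterman2025, §4.2] -/
theorem pderiv_zero_coneBlockForm (e : ℕ) :
    pderiv 0 (coneBlockForm (K := K) (e + 3)) = ((e + 2 : ℕ) : MvPolynomial (Fin 2) K) * X 1 * X 0 ^ (e + 1) := by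
  simp (config := { decide := true }) only [coneBlockForm, map_add, Derivation.leibniz, Derivation.leibniz_pow,
    pderiv_X, Pi.single_apply, if_true, if_false, smul_eq_mul, nsmul_eq_mul, mul_one, mul_zero,
    add_zero, smul_zero, show e + 3 - 1 = e + 2 by omega, show e + 2 - 1 = e + 1 by omega]
  push_cast
  ring

/-- `∂/∂z (z(z^{d−1} + y^{d−1})) = d z^{d−1} + y^{d−1}` (written with `d = e + 3`). [cite: Kloosterman2025, §4.2] -/
theorem pderiv_one_coneBlockForm (e : ℕ) :
    pderiv 1 (coneBlockForm (K := K) (e + 3)) =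
      ((e + 3 : ℕ) : MvPolynomial (Fin 2) K) * X 1 ^ (e + 2) + X 0 ^ (e + 2) := by
  simp (config := { decide := true }) only [coneBlockForm, map_add, Derivation.leibniz, Derivation.leibniz_pow,
    pderiv_X, Pi.single_apply, if_true, if_false, smul_eq_mul, nsmul_eq_mul, mul_one, mul_zero,
    add_zero, smul_zero, show e + 3 - 1 = e + 2 by omega, show e + 2 - 1 = e + 1 by omega]
  push_cast
  ring

/-- **The cone is smooth along the new variables**: `y^{2d−3}, z^{2d−3} ∈ J = ⟨∂g/∂y, ∂g/∂z⟩` for `g = z(z^{d−1} + y^{d−1})`,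
`d ≥ 3`, characteristic zero: `(d−1)·y^{2d−3} = (d−1)y^{d−2}·∂_z g − d z^{d−2}·∂_y g` and
`d(d−1)·z^d = (d−1)z·∂_z g − y·∂_y g`. [cite: Kloosterman2025, Theorem 4.9 (proof: "`X = V(f)` is smooth")] -/
theorem X_pow_mem_jacobianIdeal_coneBlockForm [CharZero K] {d : ℕ} (hd : 3 ≤ d) (i : Fin 2) :
    (X i : MvPolynomial (Fin 2) K) ^ (2 * d - 3) ∈ jacobianIdeal (coneBlockForm (K := K) d) := by
  obtain ⟨e, rfl⟩ : ∃ e, d = e + 3 := ⟨d - 3, by omega⟩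
  rw [show 2 * (e + 3) - 3 = 2 * e + 3 by omega]
  have h0 := pderiv_zero_coneBlockForm (K := K) e
  have h1 := pderiv_one_coneBlockForm (K := K) e
  revert i
  refine Fin.forall_fin_two.mpr ⟨?_, ?_⟩
  · refine mem_of_natCast_mul_mem (e + 2) (Nat.cast_ne_zero.mpr (by omega)) ?_
    have key : ((e + 2 : ℕ) : MvPolynomial (Fin 2) K) * X 0 ^ (2 * e + 3) =
        ((e + 2 : ℕ) : MvPolynomial (Fin 2) K) * X 0 ^ (e + 1) * pderiv 1 (coneBlockForm (K := K) (e + 3)) -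
          ((e + 3 : ℕ) : MvPolynomial (Fin 2) K) * X 1 ^ (e + 1) * pderiv 0 (coneBlockForm (K := K) (e + 3)) := by
      rw [h0, h1]; ring
    rw [key]
    exact Ideal.sub_mem _ (Ideal.mul_mem_left _ _ (pderiv_mem_jacobianIdeal _ _))
      (Ideal.mul_mem_left _ _ (pderiv_mem_jacobianIdeal _ _))
  · refine mem_of_natCast_mul_mem ((e + 3) * (e + 2)) (Nat.cast_ne_zero.mpr (by positivity)) ?_
    have key : (((e + 3) * (e + 2) : ℕ) : MvPolynomial (Fin 2) K) * X 1 ^ (2 * e + 3) =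
        X 1 ^ e * (((e + 2 : ℕ) : MvPolynomial (Fin 2) K) * X 1 * pderiv 1 (coneBlockForm (K := K) (e + 3)) -
          X 0 * pderiv 0 (coneBlockForm (K := K) (e + 3))) := by
      rw [h0, h1]; push_cast; ring
    rw [key]
    exact Ideal.mul_mem_left _ _ (Ideal.sub_mem _ (Ideal.mul_mem_left _ _ (pderiv_mem_jacobianIdeal _ _))
      (Ideal.mul_mem_left _ _ (pderiv_mem_jacobianIdeal _ _)))

end ConeBlock

/-! ### The `m`-fold cone of a hypersurface in Kloosterman's normal form -/

section IteratedCone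

open DuqueFrancoVillaflor2025 HodgeTheory Motives.UniversalHypersurface

variable {K : Type*} [Field K] {k₀ c r₀ : ℕ}

/-- The variables of the `m`-fold cone: the `2k₀+2` old ones, and `m` new pairs `(y_i, z_i) = (x_{(i,0)}, x_{(i,1)})`,
numbered `x_{2k₀+2+2i}, x_{2k₀+3+2i}` ("`f̃ = f + x_{2k+3}^d + x_{2k+3}x_{2k+2}^{d−1}`", iterated).
[cite: Kloosterman2025, §4.2 (before Proposition 4.7)] -/
def coneVarEquiv (k₀ m : ℕ) : Fin (2 * k₀ + 2) ⊕ (Fin m × Fin 2) ≃ Fin (2 * (k₀ + m) + 2) :=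
  ((Equiv.refl _).sumCongr finProdFinEquiv).trans (finSumFinEquiv.trans (finCongr (by ring)))

/-- Old variables in the cone: `g ↦ g(x_0, …, x_{2k₀+1})`. [cite: Kloosterman2025, §4.2] -/
abbrev coneOld (k₀ m : ℕ) : MvPolynomial (Fin (2 * k₀ + 2)) K →ₐ[K] MvPolynomial (Fin (2 * (k₀ + m) + 2)) K :=
  rename (coneVarEquiv k₀ m ∘ Sum.inl)

/-- The new variable `y_i = x_{2k₀+2+2i}` (`ε = 0`) resp. `z_i = x_{2k₀+3+2i}` (`ε = 1`) of the `i`-th cone step.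
[cite: Kloosterman2025, §4.2] -/
abbrev coneNew (k₀ m : ℕ) (i : Fin m) (ε : Fin 2) : MvPolynomial (Fin (2 * (k₀ + m) + 2)) K :=
  X (coneVarEquiv k₀ m (Sum.inr (i, ε)))

/-- Linear generators `g_i` (resp. `h_j`) of a plane and the blocks `Q_{ij}`, moved to the cone unchanged.
[cite: Kloosterman2025, §4.2] -/
def coneGA (m : ℕ) (gA : Fin c → MvPolynomial (Fin (2 * k₀ + 2)) K) :
    Fin c → MvPolynomial (Fin (2 * (k₀ + m) + 2)) K := fun i => coneOld k₀ m (gA i)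

/-- The blocks `Q_{ij}` in the cone. [cite: Kloosterman2025, §4.2] -/
def coneQ (m : ℕ) (Q : Fin c → Fin c → MvPolynomial (Fin (2 * k₀ + 2)) K) :
    Fin c → Fin c → MvPolynomial (Fin (2 * (k₀ + m) + 2)) K := fun i j => coneOld k₀ m (Q i j)

/-- The shared linear generators of the cone: the old `g'_l` and the new `z_i` ("the cone `C(Y_j)` over `Y_j` in
`V(x_{2k+3})`"). [cite: Kloosterman2025, §4.2] -/
def coneGC (m : ℕ) (gC : Fin r₀ → MvPolynomial (Fin (2 * k₀ + 2)) K) :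
    Fin (r₀ + m) → MvPolynomial (Fin (2 * (k₀ + m) + 2)) K :=
  Fin.append (fun l => coneOld k₀ m (gC l)) fun i => coneNew k₀ m i 1

/-- Their cofactors: the old `P_l` and the new `z_i^{d−1} + y_i^{d−1}`. [cite: Kloosterman2025, §4.2] -/
def coneP (m d : ℕ) (P : Fin r₀ → MvPolynomial (Fin (2 * k₀ + 2)) K) :
    Fin (r₀ + m) → MvPolynomial (Fin (2 * (k₀ + m) + 2)) K :=
  Fin.append (fun l => coneOld k₀ m (P l)) fun i => coneNew k₀ m i 1 ^ (d - 1) + coneNew k₀ m i 0 ^ (d - 1)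

section Facts

variable (m d : ℕ) (gA h : Fin c → MvPolynomial (Fin (2 * k₀ + 2)) K) (gC : Fin r₀ → MvPolynomial (Fin (2 * k₀ + 2)) K)
  (Q : Fin c → Fin c → MvPolynomial (Fin (2 * k₀ + 2)) K) (P : Fin r₀ → MvPolynomial (Fin (2 * k₀ + 2)) K)

/-- The old generators `g'_l` of the cone, in the new variables. [cite: Kloosterman2025, Proposition 4.7 (proof)] -/
@[simp] theorem coneGC_castAdd (l : Fin r₀) : coneGC m gC (Fin.castAdd m l) = coneOld k₀ m (gC l) := by
  simp [coneGC]

/-- The new generators `z_i = x_{2k+3}` of the cone planes. [cite: Kloosterman2025, Proposition 4.7 (proof)] -/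
@[simp] theorem coneGC_natAdd (i : Fin m) : coneGC (k₀ := k₀) m gC (Fin.natAdd r₀ i) = coneNew k₀ m i 1 := by
  simp [coneGC]

/-- The old cofactors `P_l` of the cone. [cite: Kloosterman2025, Proposition 4.7 (proof)] -/
@[simp] theorem coneP_castAdd (l : Fin r₀) : coneP m d P (Fin.castAdd m l) = coneOld k₀ m (P l) := by
  simp [coneP]

/-- The new cofactors `z_i^{d−1} + y_i^{d−1}` (`f̃ = f + x_{2k+3}^d + x_{2k+3}x_{2k+2}^{d−1}`). [cite: Kloosterman2025, §4.2 (before Proposition 4.7)] -/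
@[simp] theorem coneP_natAdd (i : Fin m) :
    coneP (k₀ := k₀) m d P (Fin.natAdd r₀ i) = coneNew k₀ m i 1 ^ (d - 1) + coneNew k₀ m i 0 ^ (d - 1) := by
  simp [coneP]

/-- **The `m`-fold cone in normal form IS `f(x) + Σ_i z_i(z_i^{d−1} + y_i^{d−1})`** — Kloosterman's `f̃ = f + x_{2k+3}^d +
x_{2k+3}x_{2k+2}^{d−1}`, iterated `m` times, written as the join of `f` with `m` copies of the cone block.
[cite: Kloosterman2025, §4.2 (before Proposition 4.7)] -/
theorem twoPlanesForm_cone :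
    twoPlanesForm (coneGA m gA) (coneGA m h) (coneGC m gC) (coneQ m Q) (coneP m d P) =
      rename (coneVarEquiv k₀ m) (rename Sum.inl (twoPlanesForm gA h gC Q P) +
        rename Sum.inr (blockSum fun _ : Fin m => coneBlockForm d)) := by
  simp only [twoPlanesForm, coneGA, coneQ, blockSum, coneBlockForm, map_add, map_sum, map_mul, map_pow,
    rename_rename, rename_X, Fin.sum_univ_add, coneGC_castAdd, coneGC_natAdd, coneP_castAdd, coneP_natAdd]
  rw [← add_assoc]

/-- The partial derivative of the cone along an OLD variable is the old partial: `∂f̃/∂x_l = ∂f/∂x_l`.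
[cite: Kloosterman2025, Proposition 4.7 (proof)] -/
theorem pderiv_cone_old (l : Fin (2 * k₀ + 2)) :
    pderiv (coneVarEquiv k₀ m (Sum.inl l))
        (twoPlanesForm (coneGA m gA) (coneGA m h) (coneGC m gC) (coneQ m Q) (coneP m d P)) =
      coneOld k₀ m (pderiv l (twoPlanesForm gA h gC Q P)) := by
  rw [twoPlanesForm_cone, pderiv_rename (coneVarEquiv k₀ m).injective, map_add,
    pderiv_rename Sum.inl_injective]
  have hnot : (Sum.inl l : Fin (2 * k₀ + 2) ⊕ (Fin m × Fin 2)) ∉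
      (rename Sum.inr (blockSum fun _ : Fin m => coneBlockForm (K := K) d) :
        MvPolynomial (Fin (2 * k₀ + 2) ⊕ (Fin m × Fin 2)) K).vars := by
    intro hmem
    obtain ⟨j, -, hj⟩ := Finset.mem_image.mp (vars_rename _ _ hmem)
    exact Sum.inr_ne_inl hj
  rw [pderiv_eq_zero_of_notMem_vars hnot, add_zero, rename_rename]

/-- The partial derivative of the cone along a NEW variable is that of its block: `∂f̃/∂y_i = (∂g/∂y)(y_i,z_i)`,
`∂f̃/∂z_i = (∂g/∂z)(y_i,z_i)`. [cite: Kloosterman2025, Proposition 4.7 (proof)] -/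
theorem pderiv_cone_new (i : Fin m) (ε : Fin 2) :
    pderiv (coneVarEquiv k₀ m (Sum.inr (i, ε)))
        (twoPlanesForm (coneGA m gA) (coneGA m h) (coneGC m gC) (coneQ m Q) (coneP m d P)) =
      rename (coneVarEquiv k₀ m ∘ Sum.inr ∘ Prod.mk i) (pderiv ε (coneBlockForm (K := K) d)) := by
  rw [twoPlanesForm_cone, pderiv_rename (coneVarEquiv k₀ m).injective, map_add,
    pderiv_rename Sum.inr_injective]
  have hnot : (Sum.inr (i, ε) : Fin (2 * k₀ + 2) ⊕ (Fin m × Fin 2)) ∉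
      (rename Sum.inl (twoPlanesForm gA h gC Q P) : MvPolynomial (Fin (2 * k₀ + 2) ⊕ (Fin m × Fin 2)) K).vars := by
    intro hmem
    obtain ⟨j, -, hj⟩ := Finset.mem_image.mp (vars_rename _ _ hmem)
    exact Sum.inl_ne_inr hj
  rw [pderiv_eq_zero_of_notMem_vars hnot, zero_add, pderiv_blockSum, rename_rename, rename_rename]
  rfl

/-- **The cone has a finite-dimensional Jacobian ring when the base does** (`d ≥ 3`, characteristic `0`): a power of
every variable lies in `J^{f̃}` ("Then `X = V(f)` is smooth", for the iterated examples). [cite: Kloosterman2025, Theorem 4.9 (proof)] -/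
theorem exists_X_pow_mem_jacobianIdeal_cone [CharZero K] (hd : 3 ≤ d) {N₀ : ℕ} (hN₀ : 0 < N₀)
    (hXN₀ : ∀ l, (X l : MvPolynomial (Fin (2 * k₀ + 2)) K) ^ N₀ ∈ jacobianIdeal (twoPlanesForm gA h gC Q P)) :
    ∃ N, 0 < N ∧ ∀ l, (X l : MvPolynomial (Fin (2 * (k₀ + m) + 2)) K) ^ N ∈
      jacobianIdeal (twoPlanesForm (coneGA m gA) (coneGA m h) (coneGC m gC) (coneQ m Q) (coneP m d P)) := by
  set F := twoPlanesForm (coneGA m gA) (coneGA m h) (coneGC m gC) (coneQ m Q) (coneP m d P) with hF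
  refine ⟨N₀ + (2 * d - 3), by omega, fun l => ?_⟩
  obtain ⟨s, rfl⟩ := (coneVarEquiv k₀ m).surjective l
  rcases s with l | ⟨i, ε⟩
  · -- old variable: push the base certificate through `coneOld`
    refine Ideal.pow_mem_of_pow_mem _ ?_ (Nat.le_add_right N₀ _)
    have hmap : (jacobianIdeal (twoPlanesForm gA h gC Q P)).map (coneOld (K := K) k₀ m) ≤ jacobianIdeal F := by
      rw [jacobianIdeal, Ideal.map_span]
      refine Ideal.span_le.mpr ?_
      rintro _ ⟨_, ⟨l', rfl⟩, rfl⟩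
      rw [SetLike.mem_coe, hF, ← pderiv_cone_old]
      exact pderiv_mem_jacobianIdeal _ _
    have h1 := Ideal.mem_map_of_mem (coneOld (K := K) k₀ m) (hXN₀ l)
    rw [map_pow, rename_X] at h1
    exact hmap h1
  · -- new variable: the block certificate
    refine Ideal.pow_mem_of_pow_mem _ ?_ (Nat.le_add_left _ N₀)
    have hmap : (jacobianIdeal (coneBlockForm (K := K) d)).map
        (rename (coneVarEquiv k₀ m ∘ Sum.inr ∘ Prod.mk i) :
          MvPolynomial (Fin 2) K →ₐ[K] MvPolynomial (Fin (2 * (k₀ + m) + 2)) K) ≤ jacobianIdeal F := by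
      rw [jacobianIdeal, Ideal.map_span]
      refine Ideal.span_le.mpr ?_
      rintro _ ⟨_, ⟨ε', rfl⟩, rfl⟩
      rw [SetLike.mem_coe, hF, ← pderiv_cone_new]
      exact pderiv_mem_jacobianIdeal _ _
    have h1 := Ideal.mem_map_of_mem
      (rename (coneVarEquiv k₀ m ∘ Sum.inr ∘ Prod.mk i) :
        MvPolynomial (Fin 2) K →ₐ[K] MvPolynomial (Fin (2 * (k₀ + m) + 2)) K)
      (X_pow_mem_jacobianIdeal_coneBlockForm (K := K) hd ε)
    rw [map_pow, rename_X] at h1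
    exact hmap h1

end Facts

/-! ### Degrees of the cone data -/

section Degrees

variable {m d : ℕ} {gA h : Fin c → MvPolynomial (Fin (2 * k₀ + 2)) K} {gC : Fin r₀ → MvPolynomial (Fin (2 * k₀ + 2)) K}
  {Q : Fin c → Fin c → MvPolynomial (Fin (2 * k₀ + 2)) K} {P : Fin r₀ → MvPolynomial (Fin (2 * k₀ + 2)) K}

/-- The old linear forms stay linear in the cone. [cite: Kloosterman2025, §4.2] -/
theorem isHomogeneous_coneGA {n : ℕ} (hgA : ∀ i, (gA i).IsHomogeneous n) (i : Fin c) :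
    (coneGA m gA i).IsHomogeneous n := (hgA i).rename_isHomogeneous

/-- The blocks `Q_{ij}` keep their degree in the cone. [cite: Kloosterman2025, §4.2] -/
theorem isHomogeneous_coneQ {n : ℕ} (hQ : ∀ i j, (Q i j).IsHomogeneous n) (i j : Fin c) :
    (coneQ m Q i j).IsHomogeneous n := (hQ i j).rename_isHomogeneous

/-- The shared generators of the cone are linear forms. [cite: Kloosterman2025, §4.2] -/
theorem isHomogeneous_coneGC (hgC : ∀ l, (gC l).IsHomogeneous 1) (l : Fin (r₀ + m)) :
    (coneGC m gC l).IsHomogeneous 1 := by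
  induction l using Fin.addCases with
  | left l => rw [coneGC_castAdd]; exact (hgC l).rename_isHomogeneous
  | right i => rw [coneGC_natAdd]; exact isHomogeneous_X K _

/-- Their cofactors are forms of degree `d − 1`. [cite: Kloosterman2025, §4.2] -/
theorem isHomogeneous_coneP (hP : ∀ l, (P l).IsHomogeneous (d - 1)) (l : Fin (r₀ + m)) :
    (coneP m d P l).IsHomogeneous (d - 1) := by
  induction l using Fin.addCases with
  | left l => rw [coneP_castAdd]; exact (hP l).rename_isHomogeneous
  | right i => rw [coneP_natAdd]; exact (isHomogeneous_X_pow _ _).add (isHomogeneous_X_pow _ _)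

end Degrees

/-! ### `I(Π̃_j) = (I(Π_j)·S̃ + ⟨y_i^{d−1}, z_i⟩_i)` relabelled: the Gorenstein ideals of the cone are the joins -/

section Ideals

variable (m d : ℕ) (κ₀ : Fin c ⊕ Fin r₀ ≃ Fin (k₀ + 1)) (κ : Fin c ⊕ Fin (r₀ + m) ≃ Fin (k₀ + m + 1))
  (gA h : Fin c → MvPolynomial (Fin (2 * k₀ + 2)) K) (gC : Fin r₀ → MvPolynomial (Fin (2 * k₀ + 2)) K)
  (Q : Fin c → Fin c → MvPolynomial (Fin (2 * k₀ + 2)) K) (P : Fin r₀ → MvPolynomial (Fin (2 * k₀ + 2)) K)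

/-- Exchanging the two planes (and transposing `Q`) does not change the normal form. [cite: Kloosterman2025, §2.2] -/
theorem twoPlanesForm_swap {k : ℕ} (gA' h' : Fin c → MvPolynomial (Fin (2 * k + 2)) K)
    (gC' : Fin r₀ → MvPolynomial (Fin (2 * k + 2)) K) (Q' : Fin c → Fin c → MvPolynomial (Fin (2 * k + 2)) K)
    (P' : Fin r₀ → MvPolynomial (Fin (2 * k + 2)) K) :
    twoPlanesForm h' gA' gC' (fun i j => Q' j i) P' = twoPlanesForm gA' h' gC' Q' P' := by
  unfold twoPlanesForm
  rw [Finset.sum_comm]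
  congr 1
  exact Finset.sum_congr rfl fun i _ => Finset.sum_congr rfl fun j _ => by ring

/-- **`Ĩ₁ ⊇ (I₁·S̃ + ⟨y_i^{d−1}, z_i⟩_i)` relabelled** — every generator of the join lands in the cone's ideal `I(Π̃₁)`:
the old generators and cofactors unchanged, `z_i` is a generator, and `y_i^{d−1} = (z_i^{d−1}+y_i^{d−1}) − z_i^{d−2}·z_i`
("`Ĩ_i = S̃ I(γ_i) + ⟨x_{2k+2}^{d−1}, x_{2k+3}⟩`"). [cite: Kloosterman2025, Proposition 4.7 (proof)] -/
theorem map_join_le_planes₁ (hd : 2 ≤ d) :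
    (((Ideal.span (Set.range (plane₁Gens κ₀ gA gC)) ⊔ Ideal.span (Set.range (plane₁Cofs κ₀ h Q P))).map
          (rename Sum.inl : MvPolynomial (Fin (2 * k₀ + 2)) K →ₐ[K] MvPolynomial (Fin (2 * k₀ + 2) ⊕ (Fin m × Fin 2)) K)) ⊔
        (blockJoin fun _ : Fin m => Ideal.span (Set.range (coneBlockGens (K := K) d))).map
          (rename Sum.inr : MvPolynomial (Fin m × Fin 2) K →ₐ[K] MvPolynomial (Fin (2 * k₀ + 2) ⊕ (Fin m × Fin 2)) K)).map
        (rename (coneVarEquiv k₀ m) :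
          MvPolynomial (Fin (2 * k₀ + 2) ⊕ (Fin m × Fin 2)) K →ₐ[K] MvPolynomial (Fin (2 * (k₀ + m) + 2)) K) ≤
      Ideal.span (Set.range (plane₁Gens κ (coneGA m gA) (coneGC m gC))) ⊔
        Ideal.span (Set.range (plane₁Cofs κ (coneGA m h) (coneQ m Q) (coneP m d P))) := by
  set L := Ideal.span (Set.range (plane₁Gens κ (coneGA m gA) (coneGC m gC))) ⊔
    Ideal.span (Set.range (plane₁Cofs κ (coneGA m h) (coneQ m Q) (coneP m d P))) with hL
  have hgens : ∀ s, plane₁Gens κ (coneGA m gA) (coneGC m gC) (κ s) ∈ L := fun s =>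
    Ideal.mem_sup_left (Ideal.subset_span ⟨κ s, rfl⟩)
  have hcofs : ∀ s, plane₁Cofs κ (coneGA m h) (coneQ m Q) (coneP m d P) (κ s) ∈ L := fun s =>
    Ideal.mem_sup_right (Ideal.subset_span ⟨κ s, rfl⟩)
  have hold : ∀ p : MvPolynomial (Fin (2 * k₀ + 2)) K,
      rename (coneVarEquiv k₀ m) (rename Sum.inl p) = coneOld k₀ m p := fun p => rename_rename _ _ _
  rw [Ideal.map_le_iff_le_comap]
  refine sup_le ?_ ?_
  · rw [Ideal.map_le_iff_le_comap]
    refine sup_le (Ideal.span_le.mpr ?_) (Ideal.span_le.mpr ?_)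
    · rintro _ ⟨l, rfl⟩
      obtain ⟨s, rfl⟩ := κ₀.surjective l
      rw [SetLike.mem_coe, Ideal.mem_comap, Ideal.mem_comap, hold]
      rcases s with i | l
      · rw [plane₁Gens_apply_inl]
        have := hgens (Sum.inl i)
        rwa [plane₁Gens_apply_inl] at this
      · rw [plane₁Gens_apply_inr]
        have := hgens (Sum.inr (Fin.castAdd m l))
        rwa [plane₁Gens_apply_inr, coneGC_castAdd] at this
    · rintro _ ⟨l, rfl⟩
      obtain ⟨s, rfl⟩ := κ₀.surjective l
      rw [SetLike.mem_coe, Ideal.mem_comap, Ideal.mem_comap, hold]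
      rcases s with i | l
      · rw [plane₁Cofs_apply_inl]
        have := hcofs (Sum.inl i)
        rw [plane₁Cofs_apply_inl] at this
        simp only [map_sum, map_mul]
        exact this
      · rw [plane₁Cofs_apply_inr]
        have := hcofs (Sum.inr (Fin.castAdd m l))
        rwa [plane₁Cofs_apply_inr, coneP_castAdd] at this
  · rw [Ideal.map_le_iff_le_comap, blockJoin]
    refine iSup_le fun i => ?_
    rw [Ideal.map_le_iff_le_comap]
    refine Ideal.span_le.mpr ?_
    rintro _ ⟨ε, rfl⟩
    rw [SetLike.mem_coe, Ideal.mem_comap, Ideal.mem_comap, Ideal.mem_comap, rename_rename, rename_rename]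
    have hz : coneNew k₀ m i 1 ∈ L := by
      have := hgens (Sum.inr (Fin.natAdd r₀ i))
      rwa [plane₁Gens_apply_inr, coneGC_natAdd] at this
    have hP' : coneNew k₀ m i 1 ^ (d - 1) + coneNew k₀ m i 0 ^ (d - 1) ∈ L := by
      have := hcofs (Sum.inr (Fin.natAdd r₀ i))
      rwa [plane₁Cofs_apply_inr, coneP_natAdd] at this
    revert ε
    refine Fin.forall_fin_two.mpr ⟨?_, ?_⟩
    · rw [coneBlockGens_zero, map_pow, rename_X]
      have e : (coneNew k₀ m i 0 : MvPolynomial (Fin (2 * (k₀ + m) + 2)) K) ^ (d - 1) =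
          (coneNew k₀ m i 1 ^ (d - 1) + coneNew k₀ m i 0 ^ (d - 1)) - coneNew k₀ m i 1 ^ (d - 2) * coneNew k₀ m i 1 := by
        rw [← pow_succ, show d - 2 + 1 = d - 1 by omega]; ring
      change coneNew k₀ m i 0 ^ (d - 1) ∈ L
      rw [e]
      exact Ideal.sub_mem _ hP' (Ideal.mul_mem_left _ _ hz)
    · rw [coneBlockGens_one, rename_X]
      exact hz

variable {m d κ₀ κ gA h gC Q P}

/-- **`I(Π̃₁)` IS the relabelled join `(I(Π₁)·S̃ + ⟨y_i^{d−1}, z_i⟩_i)`**, as Gorenstein ideals of functionals: for a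
socle functional `ℓ` of `J^{f̃}` and `ℓ⁰` of `J^f`, the Gorenstein ideal of the cycle functional `ℓ(·D̃₁)` of the cone
equals the relabelled `I(ℓ⁰(·D₁) ⊗ ℓ_C)`, `ℓ_C` a socle functional of `⟨y_i^{d−1}, z_i⟩_i` ("`Ĩ_j := I(γ̃_j) = S̃ I(γ_j) +
⟨x_{2k+2}^{d−1}, x_{2k+3}⟩`, in particular `(S̃/Ĩ_j)_r = ⊕_i x_{2k+2}^i (S/I(γ_j))_{r−i}`"): one inclusion is
`map_join_le_planes₁`, and both are Artinian Gorenstein of socle degree `(k₀+m+1)(d−2)`.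
[cite: Kloosterman2025, Proposition 4.7 (proof)] -/
theorem annIdeal_cone_plane₁_eq_map (hd : 2 ≤ d)
    (hgA : ∀ i, (gA i).IsHomogeneous 1) (hh : ∀ j, (h j).IsHomogeneous 1) (hgC : ∀ l, (gC l).IsHomogeneous 1)
    (hQ : ∀ i j, (Q i j).IsHomogeneous (d - 2)) (hP : ∀ l, (P l).IsHomogeneous (d - 1))
    {N₀ : ℕ} (hN₀ : 0 < N₀)
    (hXN₀ : ∀ l, (X l : MvPolynomial (Fin (2 * k₀ + 2)) K) ^ N₀ ∈ jacobianIdeal (twoPlanesForm gA h gC Q P))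
    {ℓ₀ : MvPolynomial (Fin (2 * k₀ + 2)) K →ₗ[K] K}
    (hℓ₀ : ∀ p, ℓ₀ (homogeneousComponent ((2 * k₀ + 2) * (d - 2)) p) = ℓ₀ p)
    (hJ₀ : annIdeal ℓ₀ = jacobianIdeal (twoPlanesForm gA h gC Q P))
    {N : ℕ} (hN : 0 < N)
    (hXN : ∀ l, (X l : MvPolynomial (Fin (2 * (k₀ + m) + 2)) K) ^ N ∈
      jacobianIdeal (twoPlanesForm (coneGA m gA) (coneGA m h) (coneGC m gC) (coneQ m Q) (coneP m d P)))
    {ℓ : MvPolynomial (Fin (2 * (k₀ + m) + 2)) K →ₗ[K] K}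
    (hℓ : ∀ p, ℓ (homogeneousComponent ((2 * (k₀ + m) + 2) * (d - 2)) p) = ℓ p)
    (hJ : annIdeal ℓ = jacobianIdeal (twoPlanesForm (coneGA m gA) (coneGA m h) (coneGC m gC) (coneQ m Q) (coneP m d P)))
    {ℓC : MvPolynomial (Fin m × Fin 2) K →ₗ[K] K} (hℓC : ∀ p, ℓC (homogeneousComponent (m * (d - 2)) p) = ℓC p)
    (hCne : ℓC ≠ 0) (hC : annIdeal ℓC = blockJoin fun _ : Fin m => Ideal.span (Set.range (coneBlockGens (K := K) d))) :
    annIdeal (ciCycleFunctional ℓ (plane₁Gens κ (coneGA m gA) (coneGC m gC))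
        (plane₁Cofs κ (coneGA m h) (coneQ m Q) (coneP m d P))) =
      (annIdeal (tensorFunctional (ciCycleFunctional ℓ₀ (plane₁Gens κ₀ gA gC) (plane₁Cofs κ₀ h Q P)) ℓC)).map
        (rename (coneVarEquiv k₀ m) :
          MvPolynomial (Fin (2 * k₀ + 2) ⊕ (Fin m × Fin 2)) K →ₐ[K] MvPolynomial (Fin (2 * (k₀ + m) + 2)) K) := by
  -- the base cycle functional
  have hXN₀' : ∀ l, (X l : MvPolynomial (Fin (2 * k₀ + 2)) K) ^ N₀ ∈
      jacobianIdeal (∑ i, plane₁Gens κ₀ gA gC i * plane₁Cofs κ₀ h Q P i) := by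
    rw [sum_plane₁Gens_mul_plane₁Cofs]; exact hXN₀
  have hJ₀' : annIdeal ℓ₀ = jacobianIdeal (∑ i, plane₁Gens κ₀ gA gC i * plane₁Cofs κ₀ h Q P i) := by
    rw [sum_plane₁Gens_mul_plane₁Cofs]; exact hJ₀
  have hann₀ := annIdeal_ciCycleFunctional (d := d) (plane₁Gens κ₀ gA gC) (plane₁Cofs κ₀ h Q P) (fun _ => 1)
    (fun _ => d - 1)
    (isHomogeneous_plane₁Gens κ₀ hgA hgC) (isHomogeneous_plane₁Cofs κ₀ hd hh hQ hP) (fun _ => Nat.one_pos)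
    (fun _ => by omega) (fun _ => by omega) hN₀ hXN₀' hJ₀'
  have hconc₀ := ciCycleFunctional_homogeneousComponent (plane₁Gens κ₀ gA gC) (plane₁Cofs κ₀ h Q P)
    (fun _ => 1) (fun _ => d - 1) (isHomogeneous_plane₁Gens κ₀ hgA hgC) (isHomogeneous_plane₁Cofs κ₀ hd hh hQ hP)
    (fun _ => Nat.one_pos) (fun _ => by omega) (fun _ => by omega) hℓ₀
  have hne₀ := ciCycleFunctional_ne_zero (d := d) (plane₁Gens κ₀ gA gC) (plane₁Cofs κ₀ h Q P) (fun _ => 1)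
    (fun _ => d - 1)
    (isHomogeneous_plane₁Gens κ₀ hgA hgC) (isHomogeneous_plane₁Cofs κ₀ hd hh hQ hP) (fun _ => Nat.one_pos)
    (fun _ => by omega) (fun _ => by omega) hN₀ hXN₀' hJ₀'
  -- the cone cycle functional
  have hgA' : ∀ i, (coneGA m gA i).IsHomogeneous 1 := isHomogeneous_coneGA hgA
  have hh' : ∀ j, (coneGA m h j).IsHomogeneous 1 := isHomogeneous_coneGA hh
  have hgC' : ∀ l, (coneGC m gC l).IsHomogeneous 1 := isHomogeneous_coneGC hgC
  have hQ' : ∀ i j, (coneQ m Q i j).IsHomogeneous (d - 2) := isHomogeneous_coneQ hQ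
  have hP' : ∀ l, (coneP m d P l).IsHomogeneous (d - 1) := isHomogeneous_coneP hP
  have hXN' : ∀ l, (X l : MvPolynomial (Fin (2 * (k₀ + m) + 2)) K) ^ N ∈
      jacobianIdeal (∑ i, plane₁Gens κ (coneGA m gA) (coneGC m gC) i *
        plane₁Cofs κ (coneGA m h) (coneQ m Q) (coneP m d P) i) := by
    rw [sum_plane₁Gens_mul_plane₁Cofs]; exact hXN
  have hJ' : annIdeal ℓ = jacobianIdeal (∑ i, plane₁Gens κ (coneGA m gA) (coneGC m gC) i *
      plane₁Cofs κ (coneGA m h) (coneQ m Q) (coneP m d P) i) := by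
    rw [sum_plane₁Gens_mul_plane₁Cofs]; exact hJ
  have hann := annIdeal_ciCycleFunctional (d := d) (plane₁Gens κ (coneGA m gA) (coneGC m gC))
    (plane₁Cofs κ (coneGA m h) (coneQ m Q) (coneP m d P)) (fun _ => 1) (fun _ => d - 1)
    (isHomogeneous_plane₁Gens κ hgA' hgC') (isHomogeneous_plane₁Cofs κ hd hh' hQ' hP') (fun _ => Nat.one_pos)
    (fun _ => by omega) (fun _ => by omega) hN hXN' hJ'
  have hconc := ciCycleFunctional_homogeneousComponent (plane₁Gens κ (coneGA m gA) (coneGC m gC))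
    (plane₁Cofs κ (coneGA m h) (coneQ m Q) (coneP m d P)) (fun _ => 1) (fun _ => d - 1)
    (isHomogeneous_plane₁Gens κ hgA' hgC') (isHomogeneous_plane₁Cofs κ hd hh' hQ' hP') (fun _ => Nat.one_pos)
    (fun _ => by omega) (fun _ => by omega) hℓ
  have hne := ciCycleFunctional_ne_zero (d := d) (plane₁Gens κ (coneGA m gA) (coneGC m gC))
    (plane₁Cofs κ (coneGA m h) (coneQ m Q) (coneP m d P)) (fun _ => 1) (fun _ => d - 1)
    (isHomogeneous_plane₁Gens κ hgA' hgC') (isHomogeneous_plane₁Cofs κ hd hh' hQ' hP') (fun _ => Nat.one_pos)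
    (fun _ => by omega) (fun _ => by omega) hN hXN' hJ'
  -- both sides are Artinian Gorenstein of socle `(k₀ + m + 1)(d − 2)`
  have hA := isArtinianGorenstein_annIdeal hconc hne
  have hB := (isArtinianGorenstein_annIdeal (tensorFunctional_homogeneousComponent hconc₀ hℓC)
    (tensorFunctional_ne_zero hne₀ hCne)).map_rename_equiv (coneVarEquiv k₀ m)
  rw [show (k₀ + 1) * (d - 2) + m * (d - 2) = (k₀ + m + 1) * (d - 2) by ring] at hB
  refine (hB.eq_of_le hA ?_).symm
  rw [hann, annIdeal_tensorFunctional_of_homogeneousComponent hℓC, hann₀, hC]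
  exact map_join_le_planes₁ m d κ₀ κ gA h gC Q P hd

end Ideals

/-! ### Theorem 4.9's induction, all steps at once: the exceptional set of the `m`-fold cone -/

section Main

variable {m d : ℕ} {κ₀ : Fin c ⊕ Fin r₀ ≃ Fin (k₀ + 1)} {κ : Fin c ⊕ Fin (r₀ + m) ≃ Fin (k₀ + m + 1)}
  {gA h : Fin c → MvPolynomial (Fin (2 * k₀ + 2)) K} {gC : Fin r₀ → MvPolynomial (Fin (2 * k₀ + 2)) K}
  {Q : Fin c → Fin c → MvPolynomial (Fin (2 * k₀ + 2)) K} {P : Fin r₀ → MvPolynomial (Fin (2 * k₀ + 2)) K}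

/-- `(I.map (rename θ)).map (rename θ⁻¹) = I`. [folklore] -/
private theorem map_rename_map_rename_symm {α β : Type*} (θ : α ≃ β) (I : Ideal (MvPolynomial α K)) :
    (I.map (rename θ : MvPolynomial α K →ₐ[K] MvPolynomial β K)).map
        (rename θ.symm : MvPolynomial β K →ₐ[K] MvPolynomial α K) = I := by
  ext q
  rw [mem_map_rename_equiv_iff', Equiv.symm_symm, mem_map_rename_equiv_iff', rename_rename, Equiv.symm_comp_self,
    rename_id, AlgHom.id_apply]

/-- Pulling a non-zero functional back along a relabelling keeps it non-zero. [folklore] -/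
private theorem comp_rename_ne_zero {α β : Type*} (θ : α ≃ β) {ℓ : MvPolynomial β K →ₗ[K] K} (hℓ : ℓ ≠ 0) :
    ℓ ∘ₗ (rename θ : MvPolynomial α K →ₐ[K] MvPolynomial β K).toLinearMap ≠ 0 := by
  intro h0
  apply hℓ
  refine LinearMap.ext fun q => ?_
  have := LinearMap.congr_fun h0 (rename θ.symm q)
  simpa only [LinearMap.coe_comp, Function.comp_apply, AlgHom.toLinearMap_apply, rename_rename,
    Equiv.self_comp_symm, rename_id, AlgHom.id_apply, LinearMap.zero_apply] using this

/-- **Theorem 4.9, the induction (base `⇒` every `k`), for hypersurfaces in normal form.** Let `f` be in Kloosterman's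
normal form for two `k₀`-planes (degree `d ≥ 3`, characteristic `0`) with finite-dimensional Jacobian ring, `ℓ₀` a socle
functional of `J^f`, and let `f̃` be its `m`-fold cone (two `(k₀+m)`-planes in `ℙ^{2(k₀+m)+1}`), `ℓ` a socle functional of
`J^{f̃}` (these exist: `exists_X_pow_mem_jacobianIdeal_cone`, `exists_annIdeal_eq_jacobianIdeal_twoPlanesForm`). With
`ℓ_j = ℓ(·D̃_j)`, `ℓ⁰_j = ℓ₀(·D_j)` the cycle functionals of the two planes:
(1) if the exceptional sets `E_{a'}(ℓ⁰₁,ℓ⁰₂)` of `f` are finite for all `a' ≤ a`, then `E_a(ℓ₁,ℓ₂)` is finite;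
(2) if moreover `E_{a'}(ℓ⁰₁,ℓ⁰₂) = ∅` for `a' < a`, then `#E_a(ℓ₁,ℓ₂) ≤ #E_a(ℓ⁰₁,ℓ⁰₂)` ("the induction step is Proposition
4.7 … In particular the number of `λ`, where the rank drops, does not increase"). [cite: Kloosterman2025, Theorem 4.9 (proof),
Proposition 4.7] -/
theorem excessSet_cone [CharZero K] (hd : 3 ≤ d)
    (hgA : ∀ i, (gA i).IsHomogeneous 1) (hh : ∀ j, (h j).IsHomogeneous 1) (hgC : ∀ l, (gC l).IsHomogeneous 1)
    (hQ : ∀ i j, (Q i j).IsHomogeneous (d - 2)) (hP : ∀ l, (P l).IsHomogeneous (d - 1))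
    {N₀ : ℕ} (hN₀ : 0 < N₀)
    (hXN₀ : ∀ l, (X l : MvPolynomial (Fin (2 * k₀ + 2)) K) ^ N₀ ∈ jacobianIdeal (twoPlanesForm gA h gC Q P))
    {ℓ₀ : MvPolynomial (Fin (2 * k₀ + 2)) K →ₗ[K] K}
    (hℓ₀ : ∀ p, ℓ₀ (homogeneousComponent ((2 * k₀ + 2) * (d - 2)) p) = ℓ₀ p)
    (hJ₀ : annIdeal ℓ₀ = jacobianIdeal (twoPlanesForm gA h gC Q P))
    {ℓ : MvPolynomial (Fin (2 * (k₀ + m) + 2)) K →ₗ[K] K}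
    (hℓ : ∀ p, ℓ (homogeneousComponent ((2 * (k₀ + m) + 2) * (d - 2)) p) = ℓ p)
    (hJ : annIdeal ℓ = jacobianIdeal (twoPlanesForm (coneGA m gA) (coneGA m h) (coneGC m gC) (coneQ m Q) (coneP m d P)))
    (a : ℕ) :
    ((∀ a' ≤ a, (excessSet (ciCycleFunctional ℓ₀ (plane₁Gens κ₀ gA gC) (plane₁Cofs κ₀ h Q P))
        (ciCycleFunctional ℓ₀ (plane₂Gens κ₀ h gC) (plane₂Cofs κ₀ gA Q P)) a').Finite) →
      (excessSet (ciCycleFunctional ℓ (plane₁Gens κ (coneGA m gA) (coneGC m gC))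
          (plane₁Cofs κ (coneGA m h) (coneQ m Q) (coneP m d P)))
        (ciCycleFunctional ℓ (plane₂Gens κ (coneGA m h) (coneGC m gC))
          (plane₂Cofs κ (coneGA m gA) (coneQ m Q) (coneP m d P))) a).Finite) ∧
    ((∀ a' < a, excessSet (ciCycleFunctional ℓ₀ (plane₁Gens κ₀ gA gC) (plane₁Cofs κ₀ h Q P))
        (ciCycleFunctional ℓ₀ (plane₂Gens κ₀ h gC) (plane₂Cofs κ₀ gA Q P)) a' = ∅) →
      (excessSet (ciCycleFunctional ℓ₀ (plane₁Gens κ₀ gA gC) (plane₁Cofs κ₀ h Q P))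
        (ciCycleFunctional ℓ₀ (plane₂Gens κ₀ h gC) (plane₂Cofs κ₀ gA Q P)) a).Finite →
      (excessSet (ciCycleFunctional ℓ (plane₁Gens κ (coneGA m gA) (coneGC m gC))
          (plane₁Cofs κ (coneGA m h) (coneQ m Q) (coneP m d P)))
        (ciCycleFunctional ℓ (plane₂Gens κ (coneGA m h) (coneGC m gC))
          (plane₂Cofs κ (coneGA m gA) (coneQ m Q) (coneP m d P))) a).ncard ≤
      (excessSet (ciCycleFunctional ℓ₀ (plane₁Gens κ₀ gA gC) (plane₁Cofs κ₀ h Q P))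
        (ciCycleFunctional ℓ₀ (plane₂Gens κ₀ h gC) (plane₂Cofs κ₀ gA Q P)) a).ncard) := by
  have hd2 : 2 ≤ d := by omega
  obtain ⟨N, hN, hXN⟩ := exists_X_pow_mem_jacobianIdeal_cone m d gA h gC Q P hd hN₀ hXN₀
  -- the socle functional of the block ideal `⟨y_i^{d−1}, z_i⟩_i`
  have hCAG := isArtinianGorenstein_blockJoin (K := K)
    (I := fun _ : Fin m => Ideal.span (Set.range (coneBlockGens (K := K) d)))
    (s := fun _ => d - 2) fun _ => isArtinianGorenstein_coneBlock hd2
  rw [Finset.sum_const, Finset.card_univ, Fintype.card_fin, smul_eq_mul] at hCAG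
  obtain ⟨ℓC, hℓC, hCne, hC⟩ := hCAG.exists_eq_annIdeal
  -- names
  set θ := coneVarEquiv k₀ m with hθ
  set ℓ₁₀ := ciCycleFunctional ℓ₀ (plane₁Gens κ₀ gA gC) (plane₁Cofs κ₀ h Q P) with hℓ₁₀
  set ℓ₂₀ := ciCycleFunctional ℓ₀ (plane₂Gens κ₀ h gC) (plane₂Cofs κ₀ gA Q P) with hℓ₂₀
  set ℓ₁ := ciCycleFunctional ℓ (plane₁Gens κ (coneGA m gA) (coneGC m gC))
    (plane₁Cofs κ (coneGA m h) (coneQ m Q) (coneP m d P)) with hℓ₁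
  set ℓ₂ := ciCycleFunctional ℓ (plane₂Gens κ (coneGA m h) (coneGC m gC))
    (plane₂Cofs κ (coneGA m gA) (coneQ m Q) (coneP m d P)) with hℓ₂
  -- (F2) for both planes; plane 2 is plane 1 for the swapped data `(h, gA, Qᵀ)`
  have hQt : ∀ i j, (fun i j => Q j i) i j |>.IsHomogeneous (d - 2) := fun i j => hQ j i
  have hXN₀t : ∀ l, (X l : MvPolynomial (Fin (2 * k₀ + 2)) K) ^ N₀ ∈
      jacobianIdeal (twoPlanesForm h gA gC (fun i j => Q j i) P) := by
    rw [twoPlanesForm_swap]; exact hXN₀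
  have hJ₀t : annIdeal ℓ₀ = jacobianIdeal (twoPlanesForm h gA gC (fun i j => Q j i) P) := by
    rw [twoPlanesForm_swap]; exact hJ₀
  have hXNt : ∀ l, (X l : MvPolynomial (Fin (2 * (k₀ + m) + 2)) K) ^ N ∈
      jacobianIdeal (twoPlanesForm (coneGA m h) (coneGA m gA) (coneGC m gC) (coneQ m fun i j => Q j i) (coneP m d P)) := by
    rw [show (coneQ m fun i j => Q j i) = fun i j => coneQ (K := K) m Q j i from rfl, twoPlanesForm_swap]; exact hXN
  have hJt : annIdeal ℓ =
      jacobianIdeal (twoPlanesForm (coneGA m h) (coneGA m gA) (coneGC m gC) (coneQ m fun i j => Q j i) (coneP m d P)) := by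
    rw [show (coneQ m fun i j => Q j i) = fun i j => coneQ (K := K) m Q j i from rfl, twoPlanesForm_swap]; exact hJ
  have hE₁ : annIdeal ℓ₁ = (annIdeal (tensorFunctional ℓ₁₀ ℓC)).map
      (rename θ : MvPolynomial (Fin (2 * k₀ + 2) ⊕ (Fin m × Fin 2)) K →ₐ[K] MvPolynomial (Fin (2 * (k₀ + m) + 2)) K) :=
    annIdeal_cone_plane₁_eq_map hd2 hgA hh hgC hQ hP hN₀ hXN₀ hℓ₀ hJ₀ hN hXN hℓ hJ hℓC hCne hC.symm
  have hE₂ : annIdeal ℓ₂ = (annIdeal (tensorFunctional ℓ₂₀ ℓC)).map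
      (rename θ : MvPolynomial (Fin (2 * k₀ + 2) ⊕ (Fin m × Fin 2)) K →ₐ[K] MvPolynomial (Fin (2 * (k₀ + m) + 2)) K) :=
    annIdeal_cone_plane₁_eq_map (κ₀ := κ₀) (κ := κ) hd2 hh hgA hgC hQt hP hN₀ hXN₀t hℓ₀ hJ₀t hN hXNt hℓ hJt hℓC hCne
      hC.symm
  -- degrees and non-vanishing of the four functionals
  have hXN₀' : ∀ l, (X l : MvPolynomial (Fin (2 * k₀ + 2)) K) ^ N₀ ∈
      jacobianIdeal (∑ i, plane₁Gens κ₀ gA gC i * plane₁Cofs κ₀ h Q P i) := by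
    rw [sum_plane₁Gens_mul_plane₁Cofs]; exact hXN₀
  have hJ₀' : annIdeal ℓ₀ = jacobianIdeal (∑ i, plane₁Gens κ₀ gA gC i * plane₁Cofs κ₀ h Q P i) := by
    rw [sum_plane₁Gens_mul_plane₁Cofs]; exact hJ₀
  have hXN₀'' : ∀ l, (X l : MvPolynomial (Fin (2 * k₀ + 2)) K) ^ N₀ ∈
      jacobianIdeal (∑ i, plane₂Gens κ₀ h gC i * plane₂Cofs κ₀ gA Q P i) := by
    rw [sum_plane₂Gens_mul_plane₂Cofs]; exact hXN₀
  have hJ₀'' : annIdeal ℓ₀ = jacobianIdeal (∑ i, plane₂Gens κ₀ h gC i * plane₂Cofs κ₀ gA Q P i) := by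
    rw [sum_plane₂Gens_mul_plane₂Cofs]; exact hJ₀
  have hc₁₀ : ∀ p, ℓ₁₀ (homogeneousComponent ((k₀ + 1) * (d - 2)) p) = ℓ₁₀ p :=
    ciCycleFunctional_homogeneousComponent (plane₁Gens κ₀ gA gC) (plane₁Cofs κ₀ h Q P) (fun _ => 1) (fun _ => d - 1)
      (isHomogeneous_plane₁Gens κ₀ hgA hgC) (isHomogeneous_plane₁Cofs κ₀ hd2 hh hQ hP) (fun _ => Nat.one_pos)
      (fun _ => by omega) (fun _ => by omega) hℓ₀
  have hc₂₀ : ∀ p, ℓ₂₀ (homogeneousComponent ((k₀ + 1) * (d - 2)) p) = ℓ₂₀ p :=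
    ciCycleFunctional_homogeneousComponent (plane₂Gens κ₀ h gC) (plane₂Cofs κ₀ gA Q P) (fun _ => 1) (fun _ => d - 1)
      (isHomogeneous_plane₂Gens κ₀ hh hgC) (isHomogeneous_plane₂Cofs κ₀ hd2 hgA hQ hP) (fun _ => Nat.one_pos)
      (fun _ => by omega) (fun _ => by omega) hℓ₀
  have hn₁₀ : ℓ₁₀ ≠ 0 :=
    ciCycleFunctional_ne_zero (d := d) (plane₁Gens κ₀ gA gC) (plane₁Cofs κ₀ h Q P) (fun _ => 1) (fun _ => d - 1)
      (isHomogeneous_plane₁Gens κ₀ hgA hgC) (isHomogeneous_plane₁Cofs κ₀ hd2 hh hQ hP) (fun _ => Nat.one_pos)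
      (fun _ => by omega) (fun _ => by omega) hN₀ hXN₀' hJ₀'
  have hn₂₀ : ℓ₂₀ ≠ 0 :=
    ciCycleFunctional_ne_zero (d := d) (plane₂Gens κ₀ h gC) (plane₂Cofs κ₀ gA Q P) (fun _ => 1) (fun _ => d - 1)
      (isHomogeneous_plane₂Gens κ₀ hh hgC) (isHomogeneous_plane₂Cofs κ₀ hd2 hgA hQ hP) (fun _ => Nat.one_pos)
      (fun _ => by omega) (fun _ => by omega) hN₀ hXN₀'' hJ₀''
  have hgA' : ∀ i, (coneGA m gA i).IsHomogeneous 1 := isHomogeneous_coneGA hgA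
  have hh' : ∀ j, (coneGA m h j).IsHomogeneous 1 := isHomogeneous_coneGA hh
  have hgC' : ∀ l, (coneGC m gC l).IsHomogeneous 1 := isHomogeneous_coneGC hgC
  have hQ' : ∀ i j, (coneQ m Q i j).IsHomogeneous (d - 2) := isHomogeneous_coneQ hQ
  have hP' : ∀ l, (coneP m d P l).IsHomogeneous (d - 1) := isHomogeneous_coneP hP
  have hXN' : ∀ l, (X l : MvPolynomial (Fin (2 * (k₀ + m) + 2)) K) ^ N ∈
      jacobianIdeal (∑ i, plane₁Gens κ (coneGA m gA) (coneGC m gC) i *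
        plane₁Cofs κ (coneGA m h) (coneQ m Q) (coneP m d P) i) := by
    rw [sum_plane₁Gens_mul_plane₁Cofs]; exact hXN
  have hJ' : annIdeal ℓ = jacobianIdeal (∑ i, plane₁Gens κ (coneGA m gA) (coneGC m gC) i *
      plane₁Cofs κ (coneGA m h) (coneQ m Q) (coneP m d P) i) := by
    rw [sum_plane₁Gens_mul_plane₁Cofs]; exact hJ
  have hXN'' : ∀ l, (X l : MvPolynomial (Fin (2 * (k₀ + m) + 2)) K) ^ N ∈
      jacobianIdeal (∑ i, plane₂Gens κ (coneGA m h) (coneGC m gC) i *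
        plane₂Cofs κ (coneGA m gA) (coneQ m Q) (coneP m d P) i) := by
    rw [sum_plane₂Gens_mul_plane₂Cofs]; exact hXN
  have hJ'' : annIdeal ℓ = jacobianIdeal (∑ i, plane₂Gens κ (coneGA m h) (coneGC m gC) i *
      plane₂Cofs κ (coneGA m gA) (coneQ m Q) (coneP m d P) i) := by
    rw [sum_plane₂Gens_mul_plane₂Cofs]; exact hJ
  have hc₁ : ∀ p, ℓ₁ (homogeneousComponent ((k₀ + m + 1) * (d - 2)) p) = ℓ₁ p :=
    ciCycleFunctional_homogeneousComponent (plane₁Gens κ (coneGA m gA) (coneGC m gC))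
      (plane₁Cofs κ (coneGA m h) (coneQ m Q) (coneP m d P)) (fun _ => 1) (fun _ => d - 1)
      (isHomogeneous_plane₁Gens κ hgA' hgC') (isHomogeneous_plane₁Cofs κ hd2 hh' hQ' hP') (fun _ => Nat.one_pos)
      (fun _ => by omega) (fun _ => by omega) hℓ
  have hc₂ : ∀ p, ℓ₂ (homogeneousComponent ((k₀ + m + 1) * (d - 2)) p) = ℓ₂ p :=
    ciCycleFunctional_homogeneousComponent (plane₂Gens κ (coneGA m h) (coneGC m gC))
      (plane₂Cofs κ (coneGA m gA) (coneQ m Q) (coneP m d P)) (fun _ => 1) (fun _ => d - 1)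
      (isHomogeneous_plane₂Gens κ hh' hgC') (isHomogeneous_plane₂Cofs κ hd2 hgA' hQ' hP') (fun _ => Nat.one_pos)
      (fun _ => by omega) (fun _ => by omega) hℓ
  have hn₁ : ℓ₁ ≠ 0 :=
    ciCycleFunctional_ne_zero (d := d) (plane₁Gens κ (coneGA m gA) (coneGC m gC))
      (plane₁Cofs κ (coneGA m h) (coneQ m Q) (coneP m d P)) (fun _ => 1) (fun _ => d - 1)
      (isHomogeneous_plane₁Gens κ hgA' hgC') (isHomogeneous_plane₁Cofs κ hd2 hh' hQ' hP') (fun _ => Nat.one_pos)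
      (fun _ => by omega) (fun _ => by omega) hN hXN' hJ'
  have hn₂ : ℓ₂ ≠ 0 :=
    ciCycleFunctional_ne_zero (d := d) (plane₂Gens κ (coneGA m h) (coneGC m gC))
      (plane₂Cofs κ (coneGA m gA) (coneQ m Q) (coneP m d P)) (fun _ => 1) (fun _ => d - 1)
      (isHomogeneous_plane₂Gens κ hh' hgC') (isHomogeneous_plane₂Cofs κ hd2 hgA' hQ' hP') (fun _ => Nat.one_pos)
      (fun _ => by omega) (fun _ => by omega) hN hXN'' hJ''
  -- the pulled-back cone functionals `L'_j = ℓ_j ∘ rename θ` are socle functionals of the joins `I(ℓ⁰_j ⊗ ℓ_C)`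
  set L₁ := tensorFunctional ℓ₁₀ ℓC with hL₁
  set L₂ := tensorFunctional ℓ₂₀ ℓC with hL₂
  set L₁' := ℓ₁ ∘ₗ (rename θ : MvPolynomial (Fin (2 * k₀ + 2) ⊕ (Fin m × Fin 2)) K →ₐ[K]
    MvPolynomial (Fin (2 * (k₀ + m) + 2)) K).toLinearMap with hL₁'
  set L₂' := ℓ₂ ∘ₗ (rename θ : MvPolynomial (Fin (2 * k₀ + 2) ⊕ (Fin m × Fin 2)) K →ₐ[K]
    MvPolynomial (Fin (2 * (k₀ + m) + 2)) K).toLinearMap with hL₂'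
  have hdeg : (k₀ + 1) * (d - 2) + m * (d - 2) = (k₀ + m + 1) * (d - 2) := by ring
  have hcL₁ : ∀ p, L₁ (homogeneousComponent ((k₀ + m + 1) * (d - 2)) p) = L₁ p := by
    rw [← hdeg]; exact tensorFunctional_homogeneousComponent hc₁₀ hℓC
  have hcL₂ : ∀ p, L₂ (homogeneousComponent ((k₀ + m + 1) * (d - 2)) p) = L₂ p := by
    rw [← hdeg]; exact tensorFunctional_homogeneousComponent hc₂₀ hℓC
  have hcL₁' : ∀ p, L₁' (homogeneousComponent ((k₀ + m + 1) * (d - 2)) p) = L₁' p :=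
    comp_rename_homogeneousComponent θ.symm hc₁
  have hcL₂' : ∀ p, L₂' (homogeneousComponent ((k₀ + m + 1) * (d - 2)) p) = L₂' p :=
    comp_rename_homogeneousComponent θ.symm hc₂
  have hnL₁' : L₁' ≠ 0 := comp_rename_ne_zero θ hn₁
  have hnL₂' : L₂' ≠ 0 := comp_rename_ne_zero θ hn₂
  have haL₁' : annIdeal L₁' = annIdeal L₁ := by
    rw [hL₁', show (rename θ : MvPolynomial (Fin (2 * k₀ + 2) ⊕ (Fin m × Fin 2)) K →ₐ[K]
        MvPolynomial (Fin (2 * (k₀ + m) + 2)) K) = rename θ.symm.symm from rfl, annIdeal_comp_rename_symm, hE₁,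
      map_rename_map_rename_symm]
  have haL₂' : annIdeal L₂' = annIdeal L₂ := by
    rw [hL₂', show (rename θ : MvPolynomial (Fin (2 * k₀ + 2) ⊕ (Fin m × Fin 2)) K →ₐ[K]
        MvPolynomial (Fin (2 * (k₀ + m) + 2)) K) = rename θ.symm.symm from rfl, annIdeal_comp_rename_symm, hE₂,
      map_rename_map_rename_symm]
  have hcard := ncard_excessSet_eq_of_annIdeal_eq hcL₁ hcL₂ hcL₁' hcL₂' hnL₁' hnL₂' haL₁' haL₂' a
  have hsame : excessSet L₁' L₂' a = excessSet ℓ₁ ℓ₂ a := excessSet_comp_rename_symm θ.symm ℓ₁ ℓ₂ a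
  rw [hsame] at hcard
  have hsub := excessSet_tensorFunctional_subset (ℓ₁ := ℓ₁₀) (ℓ₂ := ℓ₂₀) hℓC a
  refine ⟨fun hfin => ?_, fun hempty hfin => ?_⟩
  · exact hcard.2.mpr (excessSet_tensorFunctional_finite hℓC hfin)
  · rw [hcard.1]
    exact Set.ncard_le_ncard (excessSet_tensorFunctional_subset_of_forall_lt hℓC hempty) hfin

end Main

end IteratedCone

/-! ## Section 4 — membership helpers for the two cycle ideals `I(Π₁) = (gens₁) + (cofs₁)`, `I(Π₂)` -/

section PlaneIdeals

variable {K : Type*} [Field K] {k c r : ℕ} (κ : Fin c ⊕ Fin r ≃ Fin (k + 1))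
  (gA h : Fin c → MvPolynomial (Fin (2 * k + 2)) K) (gC : Fin r → MvPolynomial (Fin (2 * k + 2)) K)
  (Q : Fin c → Fin c → MvPolynomial (Fin (2 * k + 2)) K) (P : Fin r → MvPolynomial (Fin (2 * k + 2)) K)

/-- `g_i ∈ I(Π₁)`. [cite: Kloosterman2025, §2.2, Example 3.5] -/
theorem gA_mem_plane₁ (i : Fin c) :
    gA i ∈ Ideal.span (Set.range (plane₁Gens κ gA gC)) ⊔ Ideal.span (Set.range (plane₁Cofs κ h Q P)) :=
  Ideal.mem_sup_left (Ideal.subset_span ⟨κ (Sum.inl i), plane₁Gens_apply_inl κ gA gC i⟩)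

/-- `g'_m ∈ I(Π₁)`. [cite: Kloosterman2025, §2.2, Example 3.5] -/
theorem gC_mem_plane₁ (m : Fin r) :
    gC m ∈ Ideal.span (Set.range (plane₁Gens κ gA gC)) ⊔ Ideal.span (Set.range (plane₁Cofs κ h Q P)) :=
  Ideal.mem_sup_left (Ideal.subset_span ⟨κ (Sum.inr m), plane₁Gens_apply_inr κ gA gC m⟩)

/-- `Σ_j h_j Q_{ij} ∈ I(Π₁)` (the cofactor of `g_i`). [cite: Kloosterman2025, §2.2, Example 3.5] -/
theorem sum_mem_plane₁ (i : Fin c) :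
    ∑ j, h j * Q i j ∈ Ideal.span (Set.range (plane₁Gens κ gA gC)) ⊔ Ideal.span (Set.range (plane₁Cofs κ h Q P)) :=
  Ideal.mem_sup_right (Ideal.subset_span ⟨κ (Sum.inl i), plane₁Cofs_apply_inl κ h Q P i⟩)

/-- `P_m ∈ I(Π₁)`. [cite: Kloosterman2025, §2.2, Example 3.5] -/
theorem P_mem_plane₁ (m : Fin r) :
    P m ∈ Ideal.span (Set.range (plane₁Gens κ gA gC)) ⊔ Ideal.span (Set.range (plane₁Cofs κ h Q P)) :=
  Ideal.mem_sup_right (Ideal.subset_span ⟨κ (Sum.inr m), plane₁Cofs_apply_inr κ h Q P m⟩)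

/-- `h_j ∈ I(Π₂)`. [cite: Kloosterman2025, §2.2, Example 3.5] -/
theorem h_mem_plane₂ (j : Fin c) :
    h j ∈ Ideal.span (Set.range (plane₂Gens κ h gC)) ⊔ Ideal.span (Set.range (plane₂Cofs κ gA Q P)) :=
  Ideal.mem_sup_left (Ideal.subset_span ⟨κ (Sum.inl j), plane₂Gens_apply_inl κ h gC j⟩)

/-- `g'_m ∈ I(Π₂)`. [cite: Kloosterman2025, §2.2, Example 3.5] -/
theorem gC_mem_plane₂ (m : Fin r) :
    gC m ∈ Ideal.span (Set.range (plane₂Gens κ h gC)) ⊔ Ideal.span (Set.range (plane₂Cofs κ gA Q P)) :=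
  Ideal.mem_sup_left (Ideal.subset_span ⟨κ (Sum.inr m), plane₂Gens_apply_inr κ h gC m⟩)

/-- `Σ_i g_i Q_{ij} ∈ I(Π₂)` (the cofactor of `h_j`). [cite: Kloosterman2025, §2.2, Example 3.5] -/
theorem sum_mem_plane₂ (j : Fin c) :
    ∑ i, gA i * Q i j ∈ Ideal.span (Set.range (plane₂Gens κ h gC)) ⊔ Ideal.span (Set.range (plane₂Cofs κ gA Q P)) :=
  Ideal.mem_sup_right (Ideal.subset_span ⟨κ (Sum.inl j), plane₂Cofs_apply_inl κ gA Q P j⟩)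

/-- `P_m ∈ I(Π₂)`. [cite: Kloosterman2025, §2.2, Example 3.5] -/
theorem P_mem_plane₂ (m : Fin r) :
    P m ∈ Ideal.span (Set.range (plane₂Gens κ h gC)) ⊔ Ideal.span (Set.range (plane₂Cofs κ gA Q P)) :=
  Ideal.mem_sup_right (Ideal.subset_span ⟨κ (Sum.inr m), plane₂Cofs_apply_inr κ gA Q P m⟩)

/-- `I(Π₁) ⊆ T` is checked on the `2(k+1)` generators. [cite: Kloosterman2025, §2.2, Example 3.5] -/
theorem plane₁_le {T : Ideal (MvPolynomial (Fin (2 * k + 2)) K)} (h1 : ∀ i, gA i ∈ T) (h2 : ∀ m, gC m ∈ T)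
    (h3 : ∀ i, ∑ j, h j * Q i j ∈ T) (h4 : ∀ m, P m ∈ T) :
    Ideal.span (Set.range (plane₁Gens κ gA gC)) ⊔ Ideal.span (Set.range (plane₁Cofs κ h Q P)) ≤ T := by
  refine sup_le (Ideal.span_le.mpr ?_) (Ideal.span_le.mpr ?_) <;> rintro _ ⟨l, rfl⟩ <;>
    obtain ⟨s, rfl⟩ := κ.surjective l <;> rcases s with i | m
  · rw [plane₁Gens_apply_inl]; exact h1 i
  · rw [plane₁Gens_apply_inr]; exact h2 m
  · rw [plane₁Cofs_apply_inl]; exact h3 i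
  · rw [plane₁Cofs_apply_inr]; exact h4 m

/-- `I(Π₂) ⊆ T` is checked on the `2(k+1)` generators. [cite: Kloosterman2025, §2.2, Example 3.5] -/
theorem plane₂_le {T : Ideal (MvPolynomial (Fin (2 * k + 2)) K)} (h1 : ∀ j, h j ∈ T) (h2 : ∀ m, gC m ∈ T)
    (h3 : ∀ j, ∑ i, gA i * Q i j ∈ T) (h4 : ∀ m, P m ∈ T) :
    Ideal.span (Set.range (plane₂Gens κ h gC)) ⊔ Ideal.span (Set.range (plane₂Cofs κ gA Q P)) ≤ T := by
  refine sup_le (Ideal.span_le.mpr ?_) (Ideal.span_le.mpr ?_) <;> rintro _ ⟨l, rfl⟩ <;>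
    obtain ⟨s, rfl⟩ := κ.surjective l <;> rcases s with j | m
  · rw [plane₂Gens_apply_inl]; exact h1 j
  · rw [plane₂Gens_apply_inr]; exact h2 m
  · rw [plane₂Cofs_apply_inl]; exact h3 j
  · rw [plane₂Cofs_apply_inr]; exact h4 m

end PlaneIdeals

/-! ## The cone keeps the two planes genuine (`k`-planes meeting in codimension `c`) -/

section ConeIndependence

variable {K : Type*} [Field K] {k₀ c r₀ : ℕ}

/-- The cone step keeps the linear generators `gA, h, gC` (and the new `z_i`) linearly independent: if
`Π₁ = V(gA, gC)`, `Π₂ = V(h, gC)` are two `k₀`-planes meeting in codimension `c` (i.e. the `2c + r₀ = k₀ + 1 + c`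
linear forms are linearly independent), then so are the generators of the two `(k₀+m)`-planes of the `m`-fold cone.
[cite: Kloosterman2025, Proposition 4.7 (proof), §4.2] -/
theorem linearIndependent_cone (m : ℕ) {gA h : Fin c → MvPolynomial (Fin (2 * k₀ + 2)) K}
    {gC : Fin r₀ → MvPolynomial (Fin (2 * k₀ + 2)) K}
    (hind : LinearIndependent K (Sum.elim (Sum.elim gA h) gC)) :
    LinearIndependent K (Sum.elim (Sum.elim (coneGA m gA) (coneGA m h)) (coneGC m gC)) := by
  classical
  -- reindex `(Fin c ⊕ Fin c) ⊕ Fin (r₀ + m)` as `((Fin c ⊕ Fin c) ⊕ Fin r₀) ⊕ Fin m`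
  set e : ((Fin c ⊕ Fin c) ⊕ Fin r₀) ⊕ Fin m ≃ (Fin c ⊕ Fin c) ⊕ Fin (r₀ + m) :=
    (Equiv.sumAssoc _ _ _).trans (Equiv.sumCongr (Equiv.refl _) finSumFinEquiv) with he
  rw [← linearIndependent_equiv e]
  have hψ : Function.Injective (coneVarEquiv k₀ m ∘ Sum.inl) :=
    (Equiv.injective _).comp Sum.inl_injective
  -- the old generators, renamed
  have hold : LinearIndependent K ((coneOld (K := K) k₀ m).toLinearMap ∘ Sum.elim (Sum.elim gA h) gC) :=
    hind.map' _ (LinearMap.ker_eq_bot.mpr (rename_injective _ hψ))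
  -- the new variables `z_i`
  set ez : Fin m → Fin (2 * (k₀ + m) + 2) := fun i => coneVarEquiv k₀ m (Sum.inr (i, 1)) with hez
  have hinj : Function.Injective ez := by
    intro i j hij
    have h1 : (Sum.inr (i, (1 : Fin 2)) : Fin (2 * k₀ + 2) ⊕ (Fin m × Fin 2)) = Sum.inr (j, 1) :=
      (coneVarEquiv k₀ m).injective hij
    simpa using h1
  have hnew : LinearIndependent K
      ((X : Fin (2 * (k₀ + m) + 2) → MvPolynomial (Fin (2 * (k₀ + m) + 2)) K) ∘ ez) :=
    (linearIndependent_X (Fin (2 * (k₀ + m) + 2)) K).comp ez hinj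
  have hF : (Sum.elim (Sum.elim (coneGA m gA) (coneGA m h)) (coneGC m gC)) ∘ e =
      Sum.elim ((coneOld (K := K) k₀ m).toLinearMap ∘ Sum.elim (Sum.elim gA h) gC)
        ((X : Fin (2 * (k₀ + m) + 2) → MvPolynomial (Fin (2 * (k₀ + m) + 2)) K) ∘ ez) := by
    funext x
    rcases x with ((i | j) | l) | i
    · simp [he, coneGA]
    · simp [he, coneGA]
    · simp [he]
    · simp [he, hez]
  rw [hF]
  refine hold.sum_type hnew ?_
  rw [Submodule.disjoint_def]
  intro x hx hx'
  -- `x` is a polynomial in the old variables …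
  have hx1 : x ∈ LinearMap.range (coneOld (K := K) k₀ m).toLinearMap := by
    refine (Submodule.span_le.mpr ?_) hx
    rintro _ ⟨y, rfl⟩
    exact ⟨_, rfl⟩
  obtain ⟨q, rfl⟩ := hx1
  -- … and a linear combination of the new variables
  obtain ⟨cf, hcf⟩ := (Submodule.mem_span_range_iff_exists_fun K).mp hx'
  have hc : ∀ i, cf i = 0 := by
    intro i
    have h1 : coeff (Finsupp.single (ez i) 1)
        (∑ j, cf j • ((X : Fin (2 * (k₀ + m) + 2) → MvPolynomial (Fin (2 * (k₀ + m) + 2)) K) ∘ ez) j) = cf i := by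
      simp only [Function.comp, coeff_sum, coeff_smul, coeff_X, smul_eq_mul, mul_ite, mul_one, mul_zero]
      rw [Finset.sum_eq_single i]
      · simp
      · intro j _ hj
        rw [if_neg]
        intro hji
        exact hj (hinj (Finsupp.single_left_injective one_ne_zero hji))
      · simp
    have h2 : coeff (Finsupp.single (ez i) 1) ((coneOld (K := K) k₀ m).toLinearMap q) = 0 := by
      change coeff _ (rename _ q) = 0
      refine coeff_rename_eq_zero _ _ _ fun u hu => ?_
      have hmem : ez i ∈ (Finsupp.mapDomain (coneVarEquiv k₀ m ∘ Sum.inl) u).support := by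
        rw [hu]; simp
      obtain ⟨a, -, ha⟩ := Finset.mem_image.mp (Finsupp.mapDomain_support hmem)
      have h3 : (Sum.inl a : Fin (2 * k₀ + 2) ⊕ (Fin m × Fin 2)) = Sum.inr (i, 1) :=
        (coneVarEquiv k₀ m).injective ha
      exact absurd h3 (by simp)
    rw [← hcf, h1] at h2
    exact h2
  rw [← hcf]
  simp [hc]

/-- A family of coordinate functions `x_{e(i)}` with `e` injective is linearly independent (used for the linear
generators of the two planes of Examples 4.3–4.5: "two `k`-planes intersecting in codimension `c`").
[cite: Kloosterman2025, Theorem 4.9] -/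
theorem linearIndependent_of_eq_X_comp {σ ι : Type*} (e : ι → σ) (he : Function.Injective e)
    (v : ι → MvPolynomial σ K) (hv : ∀ i, v i = X (e i)) : LinearIndependent K v := by
  have h : v = (X : σ → MvPolynomial σ K) ∘ e := funext hv
  rw [h]
  exact (linearIndependent_X σ K).comp e he

end ConeIndependence

end Literature.AlgebraicGeometry.Kloosterman2025

end
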